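import Mathlib
import Literature.Combinatorics.SimpleGraph.LovaszTheta
import Literature.Computability.Complexity.ExtMonotoneGates
import Literature.Computability.Complexity.CliqueTestGraphs
import Literature.Computability.Complexity.MonotoneSwitching
import Summits.PneNP.PneNP.Theorems.ConvexRankGatesThetaGateKillsRazborovPair

/-!
# `stub_convReplaceable` of line `width-threshold-certificate-sparsity` is FALSE (crux stmt-PneNP-10682)

Negative lemma for the crux `Summit.PneNP.PneNP.Theses.ConvexRankGates.CliqueExtLowerBound`
(item stmt-PneNP-10682), line `width-threshold-certificate-sparsity`
(`Cruxes/CliqueExtLowerBound/Lines/width-threshold-certificate-sparsity.lean`): its hardest stub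
`stub_convReplaceable : ConvReplaceableStatement` ("every CONV gate of width `≤ m^c` is REPLACEABLE,
on the referee push-forwards through local children, by a monotone `{∧,∨,0,1}`-circuit of size
`m^a`, `a = a(c)`") is refuted: `stub_convReplaceable_false : ¬ <registered stub signature>`.

THE WITNESS (the anchored Lovász theta gate). At `c = 3`, for EVERY `a`, localities `r = 3`,
`s = 4`, and every large `m = n + 2`: anchor edge `e₀ = {n+1, 0}`; derived vertices `Fin (n+1)`
(all but the anchor vertex); gate `φ = thetaGate (n+1) (k-1)`, the theta programme on the derived
vertices with clique parameter `k - 1` (`k = ⌈m^{1/4}⌉₊`), a CONV gate of description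
`4(n+1)² + 4 ≤ m³`; positive children `d_j = {{e₀, p_j}}`, negative children
`c_j = {{e₀, f(α,γ), f(β,γ)} : γ < h}` with private class edges `f(α,γ) = {α, α+γ+1}` and
`h = D⌊√D⌋`, `D = ⌊m^{1/8}⌋₊`. On an anchored positive (a `k`-clique through `e₀`) the gate sees the
clique vector of a `(k-1)`-clique and ACCEPTS; on an anchored negative (`e₀ ∈ M`) all of whose
vertices carry a class it sees a vector below a `h`-colouring vector and REJECTS. Jukna's criterion
(`Circuit.lowerBoundsCriterion`, tree) run on the DERIVED coordinates of a putative replacement `Ψ`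
of size `≤ m^a` has both exits absurd: (ii) `Ψ ≤ ⋁_{j∈I} x_j ∨ (exact r'-DNF)` rejects almost every
anchored clique although (V1) lets it reject only `ε C(m,k)` of the `C(n,k-2)` of them; (i)
`(exact s'-CNF) ≤ Ψ` accepts almost every classified anchored negative although the gate rejects
them and (V2) allows only `ε C(N,t)` such acceptances. (The same `(φ, d, c)` IS sandwichable in the
line's engine currency — `Replaceable` is strictly stronger than what `core` consumes; see the
refuter note `NegativeNote-stub_convReplaceable.md` in the crux folder.)

Sections: A the theta gate as ONE CONV gate (adapted from the landed
`ConvexRankGatesThetaGateKillsRazborovPair`, whose matrix lemmas are reused); B counting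
(supersets among `k`-subsets, binomial ratios); C the anchored instance and the values of the
children; D helper facts (span lemma, incidences of a class assignment, the sum over class
assignments); E the two finite exits (`casePos_absurd`, `caseNeg_absurd`); F asymptotics of
`k = ⌈m^{1/4}⌉₊`, `D = ⌊m^{1/8}⌋₊`; G the numeric budgets; H `params_ok` and the refutation.
-/

set_option linter.dupNamespace false

namespace Summit.PneNP.PneNP.Theorems.CliqueExtLowerBound.Negative

open Literature.Computability.Complexity Literature.Combinatorics.SimpleGraph Matrix Finset Filter

noncomputable section

/-! ## A. The theta gate -/

/-- Edge slots of `K_n` (the coordinates of the theta gate). -/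
abbrev EP (n : ℕ) : Type := (⊤ : SimpleGraph (Fin n)).edgeSet

/-- Number of coordinates of the theta gate on `n` vertices. -/
def nP (n : ℕ) : ℕ := Fintype.card (EP n)

/-- The enumeration of the coordinates. -/
def eqv (n : ℕ) : EP n ≃ Fin (nP n) := Fintype.equivFin (EP n)

/-- Constraint indices of the theta programme: `tr Y ≤ 1`, `-tr Y ≤ -1`, `-⟨J,Y⟩ ≤ -q`, `± Y_ab ≤ [x_ab]`. -/
abbrev ThI (n : ℕ) : Type := Unit ⊕ Unit ⊕ Unit ⊕ (Fin n × Fin n × Bool)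

/-- The all-ones matrix. -/
def thJ (n : ℕ) : Matrix (Fin n) (Fin n) ℝ := Matrix.of fun _ _ => 1

/-- Constraint matrices. -/
def thA (n : ℕ) : ThI n → Matrix (Fin n) (Fin n) ℝ :=
  Sum.elim (fun _ => 1) (Sum.elim (fun _ => -1) (Sum.elim (fun _ => -thJ n)
    (fun t => Matrix.single t.2.1 t.1 (if t.1 = t.2.1 then 0 else if t.2.2 then 1 else -1))))

/-- Constraint constants. -/
def thb (n q : ℕ) : ThI n → ℝ :=
  Sum.elim (fun _ => 1) (Sum.elim (fun _ => -1) (Sum.elim (fun _ => -(q : ℝ)) (fun _ => 0)))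

/-- Constraint couplings to the inputs (nonnegative). -/
def thB (n : ℕ) : ThI n → Fin (nP n) → ℝ :=
  Sum.elim (fun _ _ => 0) (Sum.elim (fun _ _ => 0) (Sum.elim (fun _ _ => 0)
    (fun t j => if (((eqv n).symm j : EP n) : Sym2 (Fin n)) = s(t.1, t.2.1) then 1 else 0)))

/-- Feasibility of the theta programme at the input `v` (Lovász 1979; Jukna 2012, Lemma 9.27). [folklore] -/
def ThetaFeas (n q : ℕ) (v : Fin (nP n) → Bool) : Prop :=
  ∃ Y : Matrix (Fin n) (Fin n) ℝ, Y.PosSemidef ∧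
    ∀ o : ThI n, (thA n o * Y).trace ≤ thb n q o + ∑ j, thB n o j * (if v j then (1 : ℝ) else 0)

open Classical in
/-- **The theta gate** on `n` vertices with clique parameter `q`. -/
abbrev thetaGate (n q : ℕ) : GateFn := ⟨nP n, fun v => decide (ThetaFeas n q v)⟩

theorem thetaGate_fst (n q : ℕ) : (thetaGate n q).1 = nP n := rfl

theorem thetaGate_snd_eq_true_iff (n q : ℕ) (v : Fin (nP n) → Bool) :
    (thetaGate n q).2 v = true ↔ ThetaFeas n q v := by
  classical
  simp

theorem thB_nonneg (n : ℕ) (o : ThI n) (j : Fin (nP n)) : 0 ≤ thB n o j := by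
  rcases o with _ | _ | _ | t
  · simp [thB]
  · simp [thB]
  · simp [thB]
  · simp only [thB, Sum.elim_inr]
    split_ifs <;> norm_num

theorem card_ThI (n : ℕ) : Fintype.card (ThI n) = 3 + 2 * n ^ 2 := by
  simp [Fintype.card_sum, Fintype.card_prod, Fintype.card_bool, Fintype.card_unique]
  ring

/-- The theta gate is a CONV gate of description `≤ 4 n² + 4`. -/
theorem thetaGate_isConvGate (n q : ℕ) : IsConvGate (4 * n ^ 2 + 4) (thetaGate n q) := by
  let p : ℕ := Fintype.card (ThI n)
  let eI : ThI n ≃ Fin p := Fintype.equivFin (ThI n)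
  refine ⟨p, n, ?_, fun i => thA n (eI.symm i), fun i => thb n q (eI.symm i),
    fun i j => thB n (eI.symm i) j, fun i j => thB_nonneg n _ j, fun v => ?_⟩
  · have hp : p = 3 + 2 * n ^ 2 := card_ThI n
    rw [hp]
    nlinarith [Nat.zero_le n, sq_nonneg (n : ℤ)]
  · rw [thetaGate_snd_eq_true_iff]
    unfold ThetaFeas
    constructor
    · rintro ⟨Y, hY, h⟩
      exact ⟨Y, hY, fun i => h (eI.symm i)⟩
    · rintro ⟨Y, hY, h⟩
      refine ⟨Y, hY, fun o => ?_⟩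
      have := h (eI o)
      simp only [Equiv.symm_apply_apply] at this
      exact this

/-- The theta gate computes a monotone function. -/
theorem thetaGate_monotone (n q : ℕ) : Monotone (thetaGate n q).2 :=
  (thetaGate_isConvGate n q).monotone

theorem thJ_mul_trace (n : ℕ) (Y : Matrix (Fin n) (Fin n) ℝ) : (thJ n * Y).trace = entrySum Y := by
  simp only [Matrix.trace, Matrix.diag, Matrix.mul_apply, thJ, Matrix.of_apply, one_mul, entrySum]
  exact Finset.sum_comm

/-- **Cliques are accepted**: the clique vector of a `q`-set (`1 ≤ q`) is theta-feasible
(`Y = q⁻¹ 𝟙_S 𝟙_Sᵀ`). -/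
theorem thetaFeas_cliqueVec {n q : ℕ} (S : Finset (Fin n)) (hS : #S = q) (hq : 1 ≤ q) :
    ThetaFeas n q (fun j => cliqueVec S ((eqv n).symm j)) := by
  classical
  have hclique : (⊤ : SimpleGraph (Fin n)).IsNClique q S :=
    ⟨fun a _ c _ hac => (SimpleGraph.top_adj a c).2 hac, hS⟩
  obtain ⟨hfeas, hval⟩ := isThetaFeasible_cliqueMatrix hclique (by omega)
  have hk1 : (1 : ℝ) ≤ q := by exact_mod_cast hq
  refine ⟨(q : ℝ)⁻¹ • vecMulVec (indVec S) (indVec S), hfeas.posSemidef, fun o => ?_⟩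
  have hentry : ∀ a c : Fin n, ((q : ℝ)⁻¹ • vecMulVec (indVec S) (indVec S)) a c =
      if a ∈ S ∧ c ∈ S then (q : ℝ)⁻¹ else 0 := fun a c => by
    simp only [Matrix.smul_apply, vecMulVec_apply, indVec, smul_eq_mul, mul_ite, mul_one,
      mul_zero]
    by_cases ha : a ∈ S <;> by_cases hc : c ∈ S <;> simp [ha, hc]
  rcases o with _ | _ | _ | ⟨a, c, sgn⟩
  · -- `tr Y ≤ 1`
    simp only [thA, thb, thB, Sum.elim_inl, Matrix.one_mul, zero_mul, Finset.sum_const_zero, add_zero]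
    exact hfeas.trace_eq_one.le
  · -- `-tr Y ≤ -1`
    simp only [thA, thb, thB, Sum.elim_inl, Sum.elim_inr, Matrix.neg_mul, Matrix.one_mul, Matrix.trace_neg,
      zero_mul, Finset.sum_const_zero, add_zero]
    exact neg_le_neg hfeas.trace_eq_one.ge
  · -- `-⟨J, Y⟩ ≤ -q`
    simp only [thA, thb, thB, Sum.elim_inl, Sum.elim_inr, Matrix.neg_mul, Matrix.trace_neg, zero_mul,
      Finset.sum_const_zero, add_zero]
    rw [thJ_mul_trace, hval]
  · -- `± Y_ac ≤ [x_ac]`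
    simp only [thA, thb, thB, Sum.elim_inr, Matrix.trace_single_mul, smul_eq_mul, zero_add]
    by_cases hac : a = c
    · rw [if_pos hac, zero_mul]
      exact Summit.PneNP.PneNP.Theorems.sum_edge_indicator_nonneg (eqv n) (cliqueVec S) _
    · rw [if_neg hac, Summit.PneNP.PneNP.Theorems.sum_edge_indicator (eqv n) (cliqueVec S) hac, hentry]
      simp only [cliqueVec, decide_eq_true_eq, Sym2.mem_iff, forall_eq_or_imp, forall_eq]
      have hkinv : (0 : ℝ) ≤ (q : ℝ)⁻¹ := by positivity
      have hkinv1 : (q : ℝ)⁻¹ ≤ 1 := inv_le_one_of_one_le₀ hk1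
      by_cases hS2 : a ∈ S ∧ c ∈ S <;> cases sgn <;> simp [hS2] <;> linarith

/-- **Colourings are rejected**: a `c`-colouring vector with `c < q` is theta-infeasible
(`q ≤ ⟨J, Y⟩ ≤ c`). -/
theorem not_thetaFeas_colorVec {n q c : ℕ} (h : Fin n → Fin c) (hc : c < q) :
    ¬ ThetaFeas n q (fun j => colorVec h ((eqv n).symm j)) := by
  classical
  rintro ⟨Y, hY, hcon⟩
  -- `tr Y = 1`
  have htr : Y.trace = 1 := by
    have h1 := hcon (Sum.inl ())
    have h2 := hcon (Sum.inr (Sum.inl ()))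
    simp only [thA, thb, thB, Sum.elim_inl, Sum.elim_inr, Matrix.one_mul, Matrix.neg_mul,
      Matrix.trace_neg, zero_mul, Finset.sum_const_zero, add_zero] at h1 h2
    linarith
  -- `q ≤ ⟨J, Y⟩`
  have hsum : (q : ℝ) ≤ entrySum Y := by
    have h3 := hcon (Sum.inr (Sum.inr (Sum.inl ())))
    simp only [thA, thb, thB, Sum.elim_inl, Sum.elim_inr, Matrix.neg_mul, Matrix.trace_neg,
      zero_mul, Finset.sum_const_zero, add_zero] at h3
    rw [thJ_mul_trace] at h3
    linarith
  -- `Y` vanishes off the diagonal inside colour classes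
  have h0 : ∀ u v : Fin n, u ≠ v → h u = h v → Y u v = 0 := by
    intro u v huv hhuv
    have h4 := hcon (Sum.inr (Sum.inr (Sum.inr (u, v, true))))
    have h5 := hcon (Sum.inr (Sum.inr (Sum.inr (u, v, false))))
    simp only [thA, thb, thB, Sum.elim_inr, Matrix.trace_single_mul, smul_eq_mul, zero_add,
      if_neg huv, if_true] at h4 h5
    rw [Summit.PneNP.PneNP.Theorems.sum_edge_indicator (eqv n) (colorVec h) huv] at h4 h5
    simp only [colorVec, Sym2.map_mk, Sym2.mk_isDiag_iff, hhuv, decide_true, Bool.not_true,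
      Bool.false_eq_true, if_false] at h4 h5
    norm_num at h4 h5
    linarith
  have hle := Summit.PneNP.PneNP.Theorems.entrySum_le_of_classes h hY htr h0
  have hcq : (c : ℝ) + 1 ≤ q := by exact_mod_cast hc
  linarith

/-- Gate form: clique vectors (and anything above them) are accepted. -/
theorem thetaGate_accepts {n q : ℕ} (S : Finset (Fin n)) (hS : #S = q) (hq : 1 ≤ q)
    (v : Fin (nP n) → Bool) (hv : (fun j => cliqueVec S ((eqv n).symm j)) ≤ v) :
    (thetaGate n q).2 v = true := by
  have h1 : (thetaGate n q).2 (fun j => cliqueVec S ((eqv n).symm j)) = true :=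
    (thetaGate_snd_eq_true_iff n q _).2 (thetaFeas_cliqueVec S hS hq)
  have h2 := thetaGate_monotone n q hv
  by_contra hne
  have hb : (thetaGate n q).2 v = false := by simpa using hne
  exact absurd (h1.ge.trans (h2.trans hb.le)) (by decide)

/-- Gate form: colouring vectors with fewer than `q` colours (and anything below them) are rejected. -/
theorem thetaGate_rejects {n q c : ℕ} (h : Fin n → Fin c) (hc : c < q)
    (v : Fin (nP n) → Bool) (hv : v ≤ fun j => colorVec h ((eqv n).symm j)) :
    (thetaGate n q).2 v = false := by
  have h1 : (thetaGate n q).2 (fun j => colorVec h ((eqv n).symm j)) = false := by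
    rw [← Bool.not_eq_true, thetaGate_snd_eq_true_iff]
    exact not_thetaFeas_colorVec h hc
  have h2 := thetaGate_monotone n q hv
  by_contra hne
  have hb : (thetaGate n q).2 v = true := by simpa using hne
  exact absurd (hb.ge.trans (h2.trans h1.le)) (by decide)


/-! ## B. Counting: supersets of a fixed set among the `k`-subsets, binomial ratios -/

section Counting

variable {α : Type*} [Fintype α] [DecidableEq α]

/-- The `k`-subsets containing `S` and avoiding `F` are in bijection with the `(k - #S)`-subsets of
the complement of `S ∪ F`. [folklore] -/
theorem card_filter_supset_disjoint (S F : Finset α) (hSF : Disjoint S F) (k : ℕ) (hk : #S ≤ k) :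
    #(((univ : Finset α).powersetCard k).filter fun K => S ⊆ K ∧ Disjoint F K) =
      (Fintype.card α - (#S + #F)).choose (k - #S) := by
  have hc : #(((univ : Finset α) \ (S ∪ F)).powersetCard (k - #S)) =
      (Fintype.card α - (#S + #F)).choose (k - #S) := by
    rw [card_powersetCard, card_univ_sdiff, card_union_of_disjoint hSF]
  rw [← hc]
  refine card_bij' (fun K _ => K \ S) (fun T _ => T ∪ S) ?_ ?_ ?_ ?_
  · intro K hK
    rw [mem_filter, mem_powersetCard] at hK
    obtain ⟨⟨-, hKk⟩, hSK, hFK⟩ := hK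
    rw [mem_powersetCard]
    refine ⟨fun x hx => ?_, ?_⟩
    · rw [Finset.mem_sdiff] at hx
      rw [Finset.mem_sdiff, mem_union, not_or]
      exact ⟨mem_univ _, hx.2, fun hxF => (disjoint_left.1 hFK hxF) hx.1⟩
    · rw [card_sdiff_of_subset hSK, hKk]
  · intro T hT
    rw [mem_powersetCard] at hT
    obtain ⟨hTsub, hTk⟩ := hT
    have hTS : Disjoint T S := disjoint_left.2 fun x hxT hxS => by
      have := hTsub hxT
      rw [Finset.mem_sdiff, mem_union, not_or] at this
      exact this.2.1 hxS
    have hTF : Disjoint F T := disjoint_left.2 fun x hxF hxT => by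
      have := hTsub hxT
      rw [Finset.mem_sdiff, mem_union, not_or] at this
      exact this.2.2 hxF
    rw [mem_filter, mem_powersetCard]
    refine ⟨⟨subset_univ _, ?_⟩, subset_union_right, ?_⟩
    · rw [card_union_of_disjoint hTS, hTk]
      omega
    · exact disjoint_union_right.2 ⟨hTF, hSF.symm⟩
  · intro K hK
    rw [mem_filter] at hK
    exact sdiff_union_of_subset hK.2.1
  · intro T hT
    rw [mem_powersetCard] at hT
    have hTS : Disjoint T S := disjoint_left.2 fun x hxT hxS => by
      have := hT.1 hxT
      rw [Finset.mem_sdiff, mem_union, not_or] at this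
      exact this.2.1 hxS
    exact union_sdiff_cancel_right hTS

/-- The `k`-subsets containing `S`. [folklore] -/
theorem card_filter_supset (S : Finset α) (k : ℕ) (hk : #S ≤ k) :
    #(((univ : Finset α).powersetCard k).filter fun K => S ⊆ K) =
      (Fintype.card α - #S).choose (k - #S) := by
  have h := card_filter_supset_disjoint S ∅ (disjoint_empty_right S) k hk
  rw [card_empty, add_zero] at h
  rw [← h]
  congr 1
  exact filter_congr fun K _ => by simp

/-- Fewer required elements, more supersets. [folklore] -/
theorem card_filter_supset_mono {S S' : Finset α} (h : S' ⊆ S) (k : ℕ) :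
    #(((univ : Finset α).powersetCard k).filter fun K => S ⊆ K) ≤
      #(((univ : Finset α).powersetCard k).filter fun K => S' ⊆ K) :=
  card_le_card (fun K hK => by
    rw [mem_filter] at hK ⊢
    exact ⟨hK.1, h.trans hK.2⟩)

end Counting

/-! ### Binomial ratio inequalities (cross-multiplied, in `ℕ`) -/

/-- `C(n-j, r-j) · n^j ≤ C(n, r) · r^j` for `j ≤ r ≤ n` (the fraction of `r`-sets containing `j` fixed
points is at most `(r/n)^j`). [folklore] -/
theorem choose_sub_sub_mul_pow_le (n r : ℕ) (hr : r ≤ n) :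
    ∀ j : ℕ, j ≤ r → (n - j).choose (r - j) * n ^ j ≤ n.choose r * r ^ j := by
  intro j
  induction j with
  | zero => intro; simp
  | succ j ih =>
    intro hj
    have hj' : j < r := hj
    have key : (n - (j + 1)).choose (r - (j + 1)) * n ≤ (n - j).choose (r - j) * r := by
      have hid := Nat.add_one_mul_choose_eq (n - j - 1) (r - j - 1)
      have h1 : n - j - 1 + 1 = n - j := by omega
      have h2 : r - j - 1 + 1 = r - j := by omega
      rw [h1, h2] at hid
      -- hid : (n - j) * C(n-j-1, r-j-1) = C(n-j, r-j) * (r - j)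
      have hpos : 0 < n - j := by omega
      refine Nat.le_of_mul_le_mul_right ?_ hpos
      have e1 : (n - (j + 1)).choose (r - (j + 1)) * n * (n - j) =
          n * ((n - j) * (n - j - 1).choose (r - j - 1)) := by
        rw [show n - (j + 1) = n - j - 1 by omega, show r - (j + 1) = r - j - 1 by omega]; ring
      rw [e1, hid]
      have hineq : n * (r - j) ≤ r * (n - j) := by
        zify [hj'.le, (hj'.le.trans hr)]
        nlinarith
      calc n * ((n - j).choose (r - j) * (r - j)) = (n - j).choose (r - j) * (n * (r - j)) := by ring
        _ ≤ (n - j).choose (r - j) * (r * (n - j)) := Nat.mul_le_mul_left _ hineq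
        _ = (n - j).choose (r - j) * r * (n - j) := by ring
    calc (n - (j + 1)).choose (r - (j + 1)) * n ^ (j + 1)
        = (n - (j + 1)).choose (r - (j + 1)) * n * n ^ j := by ring
      _ ≤ (n - j).choose (r - j) * r * n ^ j := Nat.mul_le_mul_right _ key
      _ = (n - j).choose (r - j) * n ^ j * r := by ring
      _ ≤ n.choose r * r ^ j * r := Nat.mul_le_mul_right _ (ih hj'.le)
      _ = n.choose r * r ^ (j + 1) := by ring

/-- `C(n-j, r) · n^j ≤ C(n, r) · (n-r)^j` for `j ≤ n` (the fraction of `r`-sets avoiding `j` fixed points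
is at most `((n-r)/n)^j`). [folklore] -/
theorem choose_sub_mul_pow_le (n r : ℕ) :
    ∀ j : ℕ, j ≤ n → (n - j).choose r * n ^ j ≤ n.choose r * (n - r) ^ j := by
  intro j
  induction j with
  | zero => intro; simp
  | succ j ih =>
    intro hj
    have hj' : j < n := hj
    have key : (n - (j + 1)).choose r * n ≤ (n - j).choose r * (n - r) := by
      have hid := Nat.choose_mul_succ_eq (n - j - 1) r
      have h1 : n - j - 1 + 1 = n - j := by omega
      rw [h1] at hid
      -- hid : C(n-j-1, r) * (n - j) = C(n-j, r) * (n - j - r)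
      have hpos : 0 < n - j := by omega
      refine Nat.le_of_mul_le_mul_right ?_ hpos
      have e1 : (n - (j + 1)).choose r * n * (n - j) = n * ((n - j - 1).choose r * (n - j)) := by
        rw [show n - (j + 1) = n - j - 1 by omega]; ring
      rw [e1, hid]
      have hineq : n * (n - j - r) ≤ (n - r) * (n - j) := by
        rcases le_or_gt (j + r) n with hle | hlt
        · zify [hle, hj'.le, (show r ≤ n by omega), (show r ≤ n - j by omega)]
          have hr0 : (0 : ℤ) ≤ r := by positivity
          have hj0 : (0 : ℤ) ≤ j := by positivity
          nlinarith
        · rw [show n - j - r = 0 by omega]; simp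
      calc n * ((n - j).choose r * (n - j - r)) = (n - j).choose r * (n * (n - j - r)) := by ring
        _ ≤ (n - j).choose r * ((n - r) * (n - j)) := Nat.mul_le_mul_left _ hineq
        _ = (n - j).choose r * (n - r) * (n - j) := by ring
    calc (n - (j + 1)).choose r * n ^ (j + 1) = (n - (j + 1)).choose r * n * n ^ j := by ring
      _ ≤ (n - j).choose r * (n - r) * n ^ j := Nat.mul_le_mul_right _ key
      _ = (n - j).choose r * n ^ j * (n - r) := by ring
      _ ≤ n.choose r * (n - r) ^ j * (n - r) := Nat.mul_le_mul_right _ (ih hj'.le)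
      _ = n.choose r * (n - r) ^ (j + 1) := by ring


/-! ## C. The anchored instance on `n + 2` vertices

Ambient graph `K_{n+2}`; anchor edge `e₀ = {n+1, 0}`; derived vertices `Fin (n+1)` embedded by
`Fin.castSucc` (everything except the anchor vertex `n+1`); class edges
`f(α, γ) = {α, α + γ + 1 (mod n+1)}`; children `d_j = {{e₀, p_j}}`, `c_j = {{e₀, f(α,γ), f(β,γ)} : γ < h}`
for the `j`-th derived pair `p_j = {α, β}`. -/

section Instance

variable (n : ℕ)

/-- Edge slots of the ambient `K_{n+2}`. -/
abbrev EV (n : ℕ) : Type := (⊤ : SimpleGraph (Fin (n + 2))).edgeSet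

/-- The anchor vertex `a₀ = n + 1` (not a derived vertex). -/
def aA (n : ℕ) : Fin (n + 2) := Fin.last (n + 1)

/-- The anchor vertex `b₀ = 0`. -/
def bB (n : ℕ) : Fin (n + 2) := 0

theorem aA_ne_bB : aA n ≠ bB n := by
  simp [aA, bB, Fin.ext_iff]

theorem castSucc_ne_aA (α : Fin (n + 1)) : Fin.castSucc α ≠ aA n := by
  intro h
  have := congrArg Fin.val h
  simp [aA] at this
  omega

theorem mem_edgeSet_top_iff {V : Type*} {a b : V} :
    s(a, b) ∈ (⊤ : SimpleGraph V).edgeSet ↔ a ≠ b := by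
  rw [SimpleGraph.mem_edgeSet, SimpleGraph.top_adj]

/-- The anchor edge `e₀ = {a₀, b₀}`. -/
def e0 (n : ℕ) : EV n := ⟨s(aA n, bB n), mem_edgeSet_top_iff.2 (aA_ne_bB n)⟩

@[simp] theorem e0_coe : ((e0 n : EV n) : Sym2 (Fin (n + 2))) = s(aA n, bB n) := rfl

theorem map_castSucc_mem_edgeSet {p : Sym2 (Fin (n + 1))}
    (hp : p ∈ (⊤ : SimpleGraph (Fin (n + 1))).edgeSet) :
    p.map Fin.castSucc ∈ (⊤ : SimpleGraph (Fin (n + 2))).edgeSet := by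
  induction p using Sym2.ind with
  | _ a b =>
    rw [mem_edgeSet_top_iff] at hp
    rw [Sym2.map_mk, mem_edgeSet_top_iff]
    exact fun h => hp (Fin.castSucc_injective _ h)

/-- A derived pair viewed as an edge of the ambient graph. -/
def embE (n : ℕ) (p : EP (n + 1)) : EV n :=
  ⟨(p : Sym2 (Fin (n + 1))).map Fin.castSucc, map_castSucc_mem_edgeSet n p.2⟩

@[simp] theorem embE_coe (p : EP (n + 1)) :
    ((embE n p : EV n) : Sym2 (Fin (n + 2))) = (p : Sym2 (Fin (n + 1))).map Fin.castSucc := rfl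

/-- Second endpoint of the `γ`-th class edge at `α`: `α + γ + 1 (mod n + 1)`. -/
def sh (n : ℕ) (α : Fin (n + 1)) (γ : ℕ) : Fin (n + 1) :=
  ⟨(α.1 + γ + 1) % (n + 1), Nat.mod_lt _ (Nat.succ_pos n)⟩

theorem sh_val (α : Fin (n + 1)) (γ : ℕ) (hγ : γ + 1 ≤ n) :
    (sh n α γ).1 = if α.1 + γ + 1 < n + 1 then α.1 + γ + 1 else α.1 + γ + 1 - (n + 1) := by
  have hα := α.2
  simp only [sh]
  split_ifs with h
  · exact Nat.mod_eq_of_lt h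
  · rw [Nat.mod_eq_sub_mod (by omega), Nat.mod_eq_of_lt (by omega)]

theorem sh_ne (α : Fin (n + 1)) (γ : ℕ) (hγ : γ + 1 ≤ n) : sh n α γ ≠ α := by
  intro h
  have h1 := congrArg Fin.val h
  rw [sh_val n α γ hγ] at h1
  have hα := α.2
  split_ifs at h1 <;> omega

/-- The `γ`-th class edge at the derived vertex `α`, as an unordered pair of ambient vertices. -/
def fS (n : ℕ) (α : Fin (n + 1)) (γ : ℕ) : Sym2 (Fin (n + 2)) :=
  s(Fin.castSucc α, Fin.castSucc (sh n α γ))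

theorem fS_mem (α : Fin (n + 1)) {γ : ℕ} (hγ : γ + 1 ≤ n) :
    fS n α γ ∈ (⊤ : SimpleGraph (Fin (n + 2))).edgeSet := by
  rw [fS, mem_edgeSet_top_iff]
  exact fun h => sh_ne n α γ hγ (Fin.castSucc_injective _ h).symm

/-- The class edge as an edge slot (junk value `e₀` when `γ` is too large). -/
def fE (n : ℕ) (α : Fin (n + 1)) (γ : ℕ) : EV n :=
  if hγ : γ + 1 ≤ n then ⟨fS n α γ, fS_mem n α hγ⟩ else e0 n

theorem fE_coe (α : Fin (n + 1)) {γ : ℕ} (hγ : γ + 1 ≤ n) :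
    ((fE n α γ : EV n) : Sym2 (Fin (n + 2))) = fS n α γ := by
  simp [fE, hγ]

theorem fS_ne_e0 (α : Fin (n + 1)) (γ : ℕ) : fS n α γ ≠ s(aA n, bB n) := by
  intro h
  rw [fS, Sym2.eq_iff] at h
  rcases h with ⟨h1, -⟩ | ⟨-, h2⟩
  · exact castSucc_ne_aA n α h1
  · exact castSucc_ne_aA n _ h2

theorem fE_ne_e0 (α : Fin (n + 1)) {γ : ℕ} (hγ : γ + 1 ≤ n) : fE n α γ ≠ e0 n := by
  intro h
  have := congrArg (fun e : EV n => (e : Sym2 (Fin (n + 2)))) h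
  simp only [fE_coe n α hγ, e0_coe] at this
  exact fS_ne_e0 n α γ this

/-- Class edges are pairwise distinct: `f(α,γ) = f(α',γ')` forces `α = α'` and `γ = γ'`
(for `γ, γ' < h` with `2h ≤ n`). -/
theorem fS_inj {h : ℕ} (hh : 2 * h ≤ n) {α α' : Fin (n + 1)} {γ γ' : ℕ} (hγ : γ < h) (hγ' : γ' < h)
    (heq : fS n α γ = fS n α' γ') : α = α' ∧ γ = γ' := by
  have hγn : γ + 1 ≤ n := by omega
  have hγn' : γ' + 1 ≤ n := by omega
  have hα := α.2
  have hα' := α'.2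
  have v1 := sh_val n α γ hγn
  have v2 := sh_val n α' γ' hγn'
  rw [fS, fS, Sym2.eq_iff] at heq
  rcases heq with ⟨h1, h2⟩ | ⟨h1, h2⟩
  · have e1 : α = α' := Fin.castSucc_injective _ h1
    subst e1
    refine ⟨rfl, ?_⟩
    have e2 := congrArg Fin.val (Fin.castSucc_injective _ h2)
    rw [v1, v2] at e2
    split_ifs at e2 <;> omega
  · exfalso
    have e1 := congrArg Fin.val (Fin.castSucc_injective _ h1)
    have e2 := congrArg Fin.val (Fin.castSucc_injective _ h2)
    -- e1 : α = sh α' γ', e2 : sh α γ = α'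
    rw [v2] at e1
    rw [v1] at e2
    split_ifs at e1 e2 <;> omega

theorem fE_inj {h : ℕ} (hh : 2 * h ≤ n) {α α' : Fin (n + 1)} {γ γ' : ℕ} (hγ : γ < h) (hγ' : γ' < h)
    (heq : fE n α γ = fE n α' γ') : α = α' ∧ γ = γ' := by
  have := congrArg (fun e : EV n => (e : Sym2 (Fin (n + 2)))) heq
  simp only [fE_coe n α (show γ + 1 ≤ n by omega), fE_coe n α' (show γ' + 1 ≤ n by omega)] at this
  exact fS_inj n hh hγ hγ' this

/-! ### The children -/

/-- The two vertices of a derived pair. -/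
def verts (n : ℕ) (p : EP (n + 1)) : Finset (Fin (n + 1)) :=
  univ.filter fun α => α ∈ (p : Sym2 (Fin (n + 1)))

/-- The `j`-th derived pair. -/
def pr (n : ℕ) (j : Fin (nP (n + 1))) : EP (n + 1) := (eqv (n + 1)).symm j

theorem exists_eq_pair (p : EP (n + 1)) :
    ∃ α β : Fin (n + 1), α ≠ β ∧ (p : Sym2 (Fin (n + 1))) = s(α, β) := by
  obtain ⟨q, hq⟩ := p
  induction q using Sym2.ind with
  | _ a b => exact ⟨a, b, mem_edgeSet_top_iff.1 hq, rfl⟩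

theorem verts_pair {p : EP (n + 1)} {α β : Fin (n + 1)} (hp : (p : Sym2 (Fin (n + 1))) = s(α, β)) :
    verts n p = {α, β} := by
  ext v
  simp [verts, hp]

theorem card_verts (p : EP (n + 1)) : #(verts n p) = 2 := by
  obtain ⟨α, β, hne, hp⟩ := exists_eq_pair n p
  rw [verts_pair n hp, card_pair hne]

theorem mem_verts {p : EP (n + 1)} {v : Fin (n + 1)} : v ∈ verts n p ↔ v ∈ (p : Sym2 (Fin (n + 1))) := by
  simp [verts]

/-- The monomial `{e₀, p}` of the positive child at the pair `p`. -/
def mono (n : ℕ) (p : EP (n + 1)) : Finset (EV n) := {e0 n, embE n p}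

/-- POSITIVE CHILDREN `d_j = {{e₀, p_j}}` (one monomial of two edges). -/
def dd (n : ℕ) (j : Fin (nP (n + 1))) : Finset (Finset (EV n)) := {mono n (pr n j)}

/-- The clause of class `γ` at the pair `p`, as a set of unordered pairs: `{e₀} ∪ {f(α,γ) : α ∈ p}`. -/
def clauseS (n : ℕ) (p : EP (n + 1)) (γ : ℕ) : Finset (Sym2 (Fin (n + 2))) :=
  insert s(aA n, bB n) ((verts n p).image fun α => fS n α γ)

/-- The clause of class `γ` at the pair `p`, as a set of edge slots. -/
def clause (n : ℕ) (p : EP (n + 1)) (γ : ℕ) : Finset (EV n) :=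
  univ.filter fun e => (e : Sym2 (Fin (n + 2))) ∈ clauseS n p γ

/-- NEGATIVE CHILDREN `c_j = {{e₀, f(α,γ), f(β,γ)} : γ < h}` (`h` clauses of three edges). -/
def cc (n h : ℕ) (j : Fin (nP (n + 1))) : Finset (Finset (EV n)) :=
  (range h).image fun γ => clause n (pr n j) γ

theorem card_mono_le (p : EP (n + 1)) : #(mono n p) ≤ 2 := card_insert_le _ _

theorem card_clause_le (p : EP (n + 1)) (γ : ℕ) : #(clause n p γ) ≤ 3 := by
  calc #(clause n p γ) ≤ #(clauseS n p γ) := by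
        refine Finset.card_le_card_of_injOn (fun e : EV n => (e : Sym2 (Fin (n + 2)))) ?_ ?_
        · intro e he
          exact (mem_filter.1 (mem_coe.1 he)).2
        · intro e _ e' _ h
          exact Subtype.ext h
    _ ≤ #((verts n p).image fun α => fS n α γ) + 1 := card_insert_le _ _
    _ ≤ #(verts n p) + 1 := by gcongr; exact card_image_le
    _ = 3 := by rw [card_verts]

theorem dd_local (j : Fin (nP (n + 1))) : ∀ R ∈ dd n j, #R ≤ 3 - 1 := by
  intro R hR
  rw [dd, mem_singleton] at hR
  subst hR
  exact card_mono_le n _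

theorem cc_local (h : ℕ) (j : Fin (nP (n + 1))) : ∀ S ∈ cc n h j, #S ≤ 4 - 1 := by
  intro S hS
  obtain ⟨γ, -, rfl⟩ := mem_image.1 hS
  exact card_clause_le n _ γ

theorem e0_mem_clause (p : EP (n + 1)) (γ : ℕ) : e0 n ∈ clause n p γ := by
  rw [clause, mem_filter]
  exact ⟨mem_univ _, by simp [clauseS]⟩

theorem evalDNF_dd_iff (j : Fin (nP (n + 1))) (x : EV n → Bool) :
    EvalDNF (dd n j) x ↔ x (e0 n) = true ∧ x (embE n (pr n j)) = true := by
  rw [dd, EvalDNF]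
  simp only [mem_singleton, exists_eq_left, SatTerm, mono, mem_insert, forall_eq_or_imp, forall_eq]

/-- Consistency `d_j ≤ c_j`: every monomial and every clause contains the anchor edge. -/
theorem dd_le_cc (h : ℕ) (j : Fin (nP (n + 1))) (x : EV n → Bool) (hx : EvalDNF (dd n j) x) :
    EvalCNF (cc n h j) x := by
  rw [evalDNF_dd_iff] at hx
  intro S hS
  obtain ⟨γ, -, rfl⟩ := mem_image.1 hS
  exact ⟨e0 n, e0_mem_clause n _ γ, hx.1⟩

/-- At most `(n+2)²` distinct child pairs. -/
theorem card_pairs_le (h : ℕ) :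
    #((univ : Finset (Fin (nP (n + 1)))).image fun j => (dd n j, cc n h j)) ≤ (n + 2) ^ 2 := by
  calc #((univ : Finset (Fin (nP (n + 1)))).image fun j => (dd n j, cc n h j))
      ≤ #(univ : Finset (Fin (nP (n + 1)))) := card_image_le
    _ = nP (n + 1) := by simp
    _ ≤ Fintype.card (Sym2 (Fin (n + 1))) :=
        Fintype.card_le_of_injective (fun e : EP (n + 1) => (e : Sym2 (Fin (n + 1)))) Subtype.val_injective
    _ ≤ Fintype.card (Fin (n + 1) × Fin (n + 1)) :=
        Fintype.card_le_of_surjective (Sym2.mk (α := Fin (n + 1))).uncurry Sym2.mk_surjective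
    _ = (n + 1) ^ 2 := by simp [sq]
    _ ≤ (n + 2) ^ 2 := by gcongr; omega

/-! ### Values on the anchored positives -/

/-- The derived clique of an anchored `k`-set `K ∋ a₀`: its trace on the derived vertices. -/
def derS (n : ℕ) (K : Finset (Fin (n + 2))) : Finset (Fin (n + 1)) :=
  univ.filter fun α => Fin.castSucc α ∈ K

theorem map_derS {K : Finset (Fin (n + 2))} :
    (derS n K).map Fin.castSuccEmb = K.erase (aA n) := by
  ext v
  rw [Finset.mem_map, mem_erase]
  constructor
  · rintro ⟨α, hα, rfl⟩
    rw [derS, mem_filter] at hα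
    exact ⟨castSucc_ne_aA n α, hα.2⟩
  · rintro ⟨hne, hv⟩
    have hne' : v ≠ Fin.last (n + 1) := hne
    obtain ⟨α, rfl⟩ := Fin.exists_castSucc_eq.2 hne'
    refine ⟨α, ?_, rfl⟩
    rw [derS, mem_filter]
    exact ⟨mem_univ _, hv⟩

theorem card_derS {K : Finset (Fin (n + 2))} (ha : aA n ∈ K) : #(derS n K) = #K - 1 := by
  rw [← card_map Fin.castSuccEmb, map_derS, card_erase_of_mem ha]

open Classical in
/-- On an anchored positive the gate sees exactly the clique vector of the derived `(k-1)`-set. -/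
theorem dval_eq_cliqueVec {K : Finset (Fin (n + 2))} (ha : aA n ∈ K) (hb : bB n ∈ K) :
    (fun j => decide (EvalDNF (dd n j) (cliqueVec K))) =
      fun j => cliqueVec (derS n K) ((eqv (n + 1)).symm j) := by
  funext j
  obtain ⟨α, β, -, hp⟩ := exists_eq_pair n (pr n j)
  have hp' : (((eqv (n + 1)).symm j : EP (n + 1)) : Sym2 (Fin (n + 1))) = s(α, β) := hp
  have lhs : EvalDNF (dd n j) (cliqueVec K) ↔ (Fin.castSucc α ∈ K ∧ Fin.castSucc β ∈ K) := by
    rw [evalDNF_dd_iff]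
    simp only [cliqueVec, e0_coe, embE_coe, hp, Sym2.map_mk, decide_eq_true_eq, Sym2.mem_iff,
      forall_eq_or_imp, forall_eq]
    exact ⟨fun h => h.2, fun h => ⟨⟨ha, hb⟩, h⟩⟩
  have rhs : cliqueVec (derS n K) ((eqv (n + 1)).symm j) = true ↔
      (Fin.castSucc α ∈ K ∧ Fin.castSucc β ∈ K) := by
    simp only [cliqueVec, hp', decide_eq_true_eq, Sym2.mem_iff, forall_eq_or_imp, forall_eq, derS,
      mem_filter, mem_univ, true_and]
  rw [Bool.eq_iff_iff, decide_eq_true_eq, lhs, rhs]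

/-! ### Values on the anchored negatives -/

theorem mem_clause_iff {h : ℕ} (hh : 2 * h ≤ n) (p : EP (n + 1)) {γ : ℕ} (hγ : γ < h) (e : EV n) :
    e ∈ clause n p γ ↔ e = e0 n ∨ ∃ α ∈ verts n p, e = fE n α γ := by
  have hγn : γ + 1 ≤ n := by omega
  rw [clause, mem_filter, clauseS, mem_insert, mem_image]
  simp only [mem_univ, true_and]
  constructor
  · rintro (h1 | ⟨α, hα, h2⟩)
    · left
      exact Subtype.ext h1
    · right
      refine ⟨α, hα, Subtype.ext ?_⟩
      rw [fE_coe n α hγn]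
      exact h2.symm
  · rintro (rfl | ⟨α, hα, rfl⟩)
    · left; rfl
    · right
      exact ⟨α, hα, (fE_coe n α hγn).symm⟩

open Classical in
/-- On an anchored negative (`e₀ ∈ M`) the `j`-th negative child is OFF iff some class `γ < h` has
both class edges of the pair inside `M`. -/
theorem cval_false_iff {h : ℕ} (hh : 2 * h ≤ n) {M : Finset (EV n)} (he : e0 n ∈ M)
    (j : Fin (nP (n + 1))) :
    decide (EvalCNF (cc n h j) (fun e => decide (e ∉ M))) = false ↔
      ∃ γ, γ < h ∧ ∀ α ∈ verts n (pr n j), fE n α γ ∈ M := by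
  rw [decide_eq_false_iff_not]
  constructor
  · intro hnot
    by_contra hno
    apply hnot
    intro S hS
    obtain ⟨γ, hγ, rfl⟩ := mem_image.1 hS
    rw [mem_range] at hγ
    by_contra hsat
    apply hno
    refine ⟨γ, hγ, fun α hα => ?_⟩
    by_contra hαM
    refine hsat ⟨fE n α γ, (mem_clause_iff n hh _ hγ _).2 (Or.inr ⟨α, hα, rfl⟩), ?_⟩
    exact decide_eq_true hαM
  · rintro ⟨γ, hγ, hall⟩ hcnf
    obtain ⟨e, he', hx⟩ := hcnf (clause n (pr n j) γ) (mem_image.2 ⟨γ, mem_range.2 hγ, rfl⟩)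
    have hx' : e ∉ M := of_decide_eq_true hx
    rcases (mem_clause_iff n hh _ hγ e).1 he' with rfl | ⟨α, hα, rfl⟩
    · exact hx' he
    · exact hx' (hall α hα)

/-- The colouring of the derived vertices read off an anchored negative all of whose vertices carry
a class: `col α = min {γ < h : f(α,γ) ∈ M}`. -/
def col (n h : ℕ) (M : Finset (EV n)) (hM : ∀ α : Fin (n + 1), ∃ γ, γ < h ∧ fE n α γ ∈ M)
    (α : Fin (n + 1)) : Fin h :=
  ⟨Nat.find (hM α), (Nat.find_spec (hM α)).1⟩

theorem col_spec (h : ℕ) (M : Finset (EV n)) (hM : ∀ α : Fin (n + 1), ∃ γ, γ < h ∧ fE n α γ ∈ M)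
    (α : Fin (n + 1)) : fE n α (col n h M hM α).1 ∈ M :=
  (Nat.find_spec (hM α)).2

open Classical in
/-- On a fully classified anchored negative the gate sees a vector BELOW the colouring vector of `col`. -/
theorem cval_le_colorVec {h : ℕ} (hh : 2 * h ≤ n) {M : Finset (EV n)} (he : e0 n ∈ M)
    (hM : ∀ α : Fin (n + 1), ∃ γ, γ < h ∧ fE n α γ ∈ M) :
    (fun j => decide (EvalCNF (cc n h j) (fun e => decide (e ∉ M)))) ≤
      fun j => colorVec (col n h M hM) ((eqv (n + 1)).symm j) := by
  intro j
  show decide (EvalCNF (cc n h j) fun e => decide (e ∉ M)) ≤ colorVec (col n h M hM) ((eqv (n + 1)).symm j)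
  cases hc : decide (EvalCNF (cc n h j) fun e => decide (e ∉ M)) with
  | false => exact Bool.false_le _
  | true =>
    by_contra hlt
    have h2 : colorVec (col n h M hM) ((eqv (n + 1)).symm j) = false := by
      revert hlt
      cases colorVec (col n h M hM) ((eqv (n + 1)).symm j) <;> simp
    obtain ⟨α, β, -, hp⟩ := exists_eq_pair n (pr n j)
    have hp' : (((eqv (n + 1)).symm j : EP (n + 1)) : Sym2 (Fin (n + 1))) = s(α, β) := hp
    have hcol : col n h M hM α = col n h M hM β := by
      simpa [colorVec, hp', Sym2.map_mk] using h2
    have h3 : decide (EvalCNF (cc n h j) (fun e => decide (e ∉ M))) = false := by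
      rw [cval_false_iff n hh he]
      refine ⟨(col n h M hM α).1, (col n h M hM α).2, fun v hv => ?_⟩
      rw [verts_pair n hp, mem_insert, mem_singleton] at hv
      rcases hv with rfl | rfl
      · exact col_spec n h M hM _
      · rw [hcol]
        exact col_spec n h M hM _
    rw [hc] at h3
    exact Bool.noConfusion h3

end Instance

/-! ## D. Helper facts for the finite lower bound -/

section Helpers

variable (n : ℕ)

/-- The localities at which Jukna's criterion is run against a circuit of size `≤ m^a`:
any `rr a` distinct pairs span `≥ w0 a = 4a + 5` vertices, any `ss a` distinct pairs span
`≥ v0 a = 32 (a + 1)` vertices. -/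
def w0 (a : ℕ) : ℕ := 4 * a + 5

/-- See `w0`. -/
def rr (a : ℕ) : ℕ := (w0 a - 1).choose 2 + 1

/-- See `w0`. -/
def v0 (a : ℕ) : ℕ := 32 * (a + 1)

/-- See `w0`. -/
def ss (a : ℕ) : ℕ := (v0 a - 1).choose 2 + 1

theorem w0_eq (a : ℕ) : w0 a = 4 * a + 5 := rfl

theorem rr_eq (a : ℕ) : rr a = (w0 a - 1).choose 2 + 1 := rfl

theorem v0_eq (a : ℕ) : v0 a = 32 * (a + 1) := rfl

theorem ss_eq (a : ℕ) : ss a = (v0 a - 1).choose 2 + 1 := rfl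

theorem two_le_rr (a : ℕ) : 2 ≤ rr a := by
  have : 1 ≤ (w0 a - 1).choose 2 := Nat.choose_pos (by rw [w0_eq]; omega)
  rw [rr_eq]; omega

theorem two_le_ss (a : ℕ) : 2 ≤ ss a := by
  have : 1 ≤ (v0 a - 1).choose 2 := Nat.choose_pos (by rw [v0_eq]; omega)
  rw [ss_eq]; omega

-- the locality constants are never to be unfolded by automation (`(32(a+1)-1).choose 2` blows up `whnf`)
attribute [irreducible] w0 rr v0 ss

/-- `verts` determines the pair. -/
theorem verts_injective : Function.Injective (verts n) := by
  intro p p' hpp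
  obtain ⟨α, β, hne, hp⟩ := exists_eq_pair n p
  obtain ⟨α', β', -, hp'⟩ := exists_eq_pair n p'
  rw [verts_pair n hp, verts_pair n hp'] at hpp
  apply Subtype.ext
  rw [hp, hp', Sym2.eq_iff]
  have hα : α ∈ ({α', β'} : Finset (Fin (n + 1))) := hpp ▸ mem_insert_self α {β}
  have hβ : β ∈ ({α', β'} : Finset (Fin (n + 1))) := hpp ▸ mem_insert_of_mem (mem_singleton_self β)
  rw [mem_insert, mem_singleton] at hα hβ
  rcases hα with rfl | rfl <;> rcases hβ with rfl | rfl
  · exact absurd rfl hne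
  · exact Or.inl ⟨rfl, rfl⟩
  · exact Or.inr ⟨rfl, rfl⟩
  · exact absurd rfl hne

/-- The vertex set spanned by a set of coordinates (derived pairs). -/
def spanV (n : ℕ) (P : Finset (Fin (nP (n + 1)))) : Finset (Fin (n + 1)) :=
  P.biUnion fun j => verts n (pr n j)

theorem verts_subset_spanV {P : Finset (Fin (nP (n + 1)))} {j : Fin (nP (n + 1))} (hj : j ∈ P) :
    verts n (pr n j) ⊆ spanV n P :=
  subset_biUnion_of_mem (fun j => verts n (pr n j)) hj

/-- **Span lemma**: more than `C(w-1, 2)` distinct pairs span at least `w` vertices. -/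
theorem le_card_spanV (P : Finset (Fin (nP (n + 1)))) (w : ℕ) (hP : (w - 1).choose 2 < #P) :
    w ≤ #(spanV n P) := by
  have hinj : Set.InjOn (fun j => verts n (pr n j)) (P : Set (Fin (nP (n + 1)))) := by
    intro j _ j' _ hjj
    exact (eqv (n + 1)).symm.injective (verts_injective n hjj)
  have hsub : P.image (fun j => verts n (pr n j)) ⊆ (spanV n P).powersetCard 2 := by
    intro V hV
    obtain ⟨j, hj, rfl⟩ := mem_image.1 hV
    rw [mem_powersetCard]
    exact ⟨verts_subset_spanV n hj, card_verts n _⟩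
  have h1 : #P ≤ (#(spanV n P)).choose 2 := by
    calc #P = #(P.image fun j => verts n (pr n j)) := (card_image_of_injOn hinj).symm
      _ ≤ #((spanV n P).powersetCard 2) := card_le_card hsub
      _ = (#(spanV n P)).choose 2 := card_powersetCard _ _
  by_contra hlt
  have h2 : (#(spanV n P)).choose 2 ≤ (w - 1).choose 2 := Nat.choose_le_choose 2 (by omega)
  omega

/-- Anchored clique vectors determine their vertex set. -/
theorem cliqueVec_inj_of_mem {K K' : Finset (Fin (n + 2))} (hK : aA n ∈ K) (hK' : aA n ∈ K')
    (h : cliqueVec K = cliqueVec K') : K = K' := by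
  ext v
  by_cases hv : v = aA n
  · subst hv; exact ⟨fun _ => hK', fun _ => hK⟩
  · have key := congrFun h ⟨s(v, aA n), mem_edgeSet_top_iff.2 hv⟩
    simp only [cliqueVec, Sym2.mem_iff, forall_eq_or_imp, forall_eq, hK, hK', and_true] at key
    simpa using key

/-- Complement indicators determine the set. -/
theorem negVec_injective : Function.Injective fun (M : Finset (EV n)) => fun e => decide (e ∉ M) := by
  intro M M' h
  ext e
  have key := congrFun h e
  simp only [decide_eq_decide] at key
  tauto

/-! ### Incidences of a class assignment -/

variable {n}

/-- The incidences `(α, g j)` for `α ∈ p_j`, `j ∈ Q`. -/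
def Inc {Q : Finset (Fin (nP (n + 1)))} {h : ℕ} (g : Q → Fin h) : Finset (Fin (n + 1) × Fin h) :=
  (univ : Finset Q).biUnion fun j => (verts n (pr n j.1)).image fun α => (α, g j)

/-- The edge set an anchored negative must contain when `g` witnesses that all pairs of `Q` are off:
`e₀` and the class edges of the incidences. -/
def Gset (n : ℕ) {Q : Finset (Fin (nP (n + 1)))} {h : ℕ} (g : Q → Fin h) : Finset (EV n) :=
  insert (e0 n) ((Inc g).image fun x => fE n x.1 x.2.1)

theorem mem_Inc_iff {Q : Finset (Fin (nP (n + 1)))} {h : ℕ} (g : Q → Fin h) (x : Fin (n + 1) × Fin h) :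
    x ∈ Inc g ↔ ∃ j : Q, x.1 ∈ verts n (pr n j.1) ∧ g j = x.2 := by
  constructor
  · intro hx
    obtain ⟨j, -, hj⟩ := mem_biUnion.1 hx
    obtain ⟨α, hα, rfl⟩ := mem_image.1 hj
    exact ⟨j, hα, rfl⟩
  · rintro ⟨j, hj, hg⟩
    refine mem_biUnion.2 ⟨j, mem_univ _, mem_image.2 ⟨x.1, hj, ?_⟩⟩
    rw [hg]

theorem card_Gset {Q : Finset (Fin (nP (n + 1)))} {h : ℕ} (hh : 2 * h ≤ n) (g : Q → Fin h) :
    #(Gset n g) = #(Inc g) + 1 := by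
  have hinj : Set.InjOn (fun x : Fin (n + 1) × Fin h => fE n x.1 x.2.1) (Inc g : Set _) := by
    intro x _ y _ hxy
    obtain ⟨h1, h2⟩ := fE_inj n hh x.2.2 y.2.2 hxy
    exact Prod.ext h1 (Fin.ext h2)
  rw [Gset, card_insert_of_notMem, card_image_of_injOn hinj]
  intro he
  obtain ⟨x, -, hx⟩ := mem_image.1 he
  exact fE_ne_e0 n x.1 (show x.2.1 + 1 ≤ n by have := x.2.2; omega) hx

theorem card_Inc_le {Q : Finset (Fin (nP (n + 1)))} {h : ℕ} (g : Q → Fin h) : #(Inc g) ≤ 2 * #Q := by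
  calc #(Inc g) ≤ ∑ j : Q, #((verts n (pr n j.1)).image fun α => (α, g j)) := card_biUnion_le
    _ ≤ ∑ _j : Q, 2 := sum_le_sum fun j _ => card_image_le.trans (card_verts n _).le
    _ = 2 * #Q := by simp [mul_comm]

/-- Every spanned vertex carries an incidence. -/
theorem card_spanV_le_card_Inc {Q : Finset (Fin (nP (n + 1)))} {h : ℕ} (g : Q → Fin h) :
    #(spanV n Q) ≤ #(Inc g) := by
  have : spanV n Q ⊆ (Inc g).image Prod.fst := by
    intro α hα
    obtain ⟨j, hj, hα'⟩ := mem_biUnion.1 hα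
    exact mem_image.2 ⟨(α, g ⟨j, hj⟩), (mem_Inc_iff g _).2 ⟨⟨j, hj⟩, hα', rfl⟩, rfl⟩
  exact (card_le_card this).trans card_image_le

/-- Every used class carries two incidences. -/
theorem two_mul_card_image_le_card_Inc {Q : Finset (Fin (nP (n + 1)))} {h : ℕ} (g : Q → Fin h) :
    2 * #((univ : Finset Q).image g) ≤ #(Inc g) := by
  rw [card_eq_sum_card_image Prod.snd (Inc g)]
  have hR : (univ : Finset Q).image g ⊆ (Inc g).image Prod.snd := by
    intro γ hγ
    obtain ⟨j, -, rfl⟩ := mem_image.1 hγ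
    obtain ⟨α, β, -, hp⟩ := exists_eq_pair n (pr n j.1)
    refine mem_image.2 ⟨(α, g j), (mem_Inc_iff g _).2 ⟨j, ?_, rfl⟩, rfl⟩
    rw [verts_pair n hp]; exact mem_insert_self _ _
  calc 2 * #((univ : Finset Q).image g) = ∑ _γ ∈ (univ : Finset Q).image g, 2 := by simp [mul_comm]
    _ ≤ ∑ γ ∈ (univ : Finset Q).image g, #((Inc g).filter fun x => x.2 = γ) := by
        refine sum_le_sum fun γ hγ => ?_
        obtain ⟨j, -, rfl⟩ := mem_image.1 hγ
        obtain ⟨α, β, hne, hp⟩ := exists_eq_pair n (pr n j.1)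
        have hα : (α, g j) ∈ (Inc g).filter fun x => x.2 = g j :=
          mem_filter.2 ⟨(mem_Inc_iff g _).2 ⟨j, by rw [verts_pair n hp]; simp, rfl⟩, rfl⟩
        have hβ : (β, g j) ∈ (Inc g).filter fun x => x.2 = g j :=
          mem_filter.2 ⟨(mem_Inc_iff g _).2 ⟨j, by rw [verts_pair n hp]; simp, rfl⟩, rfl⟩
        have hne' : (α, g j) ≠ (β, g j) := fun h => hne (Prod.ext_iff.1 h).1
        calc 2 = #({(α, g j), (β, g j)} : Finset _) := (card_pair hne').symm
          _ ≤ _ := card_le_card (by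
              intro x hx
              rw [mem_insert, mem_singleton] at hx
              rcases hx with rfl | rfl
              · exact hα
              · exact hβ)
    _ ≤ ∑ γ ∈ (Inc g).image Prod.snd, #((Inc g).filter fun x => x.2 = γ) :=
        sum_le_sum_of_subset_of_nonneg hR fun _ _ _ => Nat.zero_le _

/-! ### The combinatorial sum over class assignments -/

/-- `h^c · D^{v'} ≤ D^{max (4 v') (2 c)}` when `h² ≤ D³`. -/
theorem pow_mul_pow_le_pow_max {h D : ℕ} (hhD : h ^ 2 ≤ D ^ 3) (hD : 1 ≤ D) (c v' : ℕ) :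
    h ^ c * D ^ v' ≤ D ^ max (4 * v') (2 * c) := by
  have hsq : (h ^ c * D ^ v') ^ 2 ≤ (D ^ max (4 * v') (2 * c)) ^ 2 := by
    have e1 : (h ^ c * D ^ v') ^ 2 = (h ^ 2) ^ c * D ^ (2 * v') := by ring
    rw [e1]
    have h3 : (h ^ 2) ^ c ≤ D ^ (3 * c) := by
      calc (h ^ 2) ^ c ≤ (D ^ 3) ^ c := Nat.pow_le_pow_left hhD c
        _ = D ^ (3 * c) := by ring
    rcases le_or_gt (2 * c) (4 * v') with hle | hlt
    · rw [max_eq_left hle]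
      calc (h ^ 2) ^ c * D ^ (2 * v') ≤ D ^ (3 * c) * D ^ (2 * v') := Nat.mul_le_mul_right _ h3
        _ = D ^ (3 * c + 2 * v') := by rw [← pow_add]
        _ ≤ D ^ (4 * v' * 2) := Nat.pow_le_pow_right hD (by omega)
        _ = (D ^ (4 * v')) ^ 2 := by ring
    · rw [max_eq_right hlt.le]
      calc (h ^ 2) ^ c * D ^ (2 * v') ≤ D ^ (3 * c) * D ^ (2 * v') := Nat.mul_le_mul_right _ h3
        _ = D ^ (3 * c + 2 * v') := by rw [← pow_add]
        _ ≤ D ^ (2 * c * 2) := Nat.pow_le_pow_right hD (by omega)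
        _ = (D ^ (2 * c)) ^ 2 := by ring
  exact (Nat.pow_le_pow_iff_left (by norm_num : (2 : ℕ) ≠ 0)).1 hsq

/-- Functions with image inside `R` number at most `#R ^ #Q`. -/
theorem card_filter_image_subset_le {ι κ : Type*} [Fintype ι] [DecidableEq ι] [Fintype κ] [DecidableEq κ]
    (R : Finset κ) :
    #((univ : Finset (ι → κ)).filter fun g => univ.image g ⊆ R) ≤ #R ^ Fintype.card ι := by
  classical
  have hsub : ((univ : Finset (ι → κ)).filter fun g => univ.image g ⊆ R) ⊆
      (univ : Finset (ι → R)).image fun g' => Subtype.val ∘ g' := by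
    intro g hg
    rw [mem_filter] at hg
    have hgR : ∀ i, g i ∈ R := fun i => hg.2 (mem_image_of_mem g (mem_univ i))
    exact mem_image.2 ⟨fun i => ⟨g i, hgR i⟩, mem_univ _, rfl⟩
  calc _ ≤ #((univ : Finset (ι → R)).image fun g' => Subtype.val ∘ g') := card_le_card hsub
    _ ≤ #(univ : Finset (ι → R)) := card_image_le
    _ = #R ^ Fintype.card ι := by simp

/-- **The sum over class assignments**: `Σ_g h^{-#range g} ≤ (q₀ + 1) q₀^{q₀}` for functions on a
`q₀`-element type. -/
theorem sum_inv_pow_card_image_le {ι : Type*} [Fintype ι] [DecidableEq ι] (h : ℕ) (hh : 1 ≤ h) :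
    ∑ g : ι → Fin h, ((h : ℝ) ^ #((univ : Finset ι).image g))⁻¹ ≤
      (Fintype.card ι + 1) * (Fintype.card ι) ^ (Fintype.card ι) := by
  classical
  set q₀ := Fintype.card ι with hq₀
  have hhpos : (0 : ℝ) < h := by exact_mod_cast hh
  -- the admissible ranges
  let 𝓡 : Finset (Finset (Fin h)) := (univ : Finset (Fin h)).powerset.filter fun R => #R ≤ q₀
  have step1 : ∀ g : ι → Fin h, ((h : ℝ) ^ #((univ : Finset ι).image g))⁻¹ ≤
      ∑ R ∈ 𝓡.filter (fun R => univ.image g ⊆ R), ((h : ℝ) ^ #R)⁻¹ := by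
    intro g
    have hmem : univ.image g ∈ 𝓡.filter (fun R => univ.image g ⊆ R) := by
      rw [mem_filter, mem_filter, mem_powerset]
      exact ⟨⟨subset_univ _, card_image_le.trans (by simp [hq₀])⟩, subset_rfl⟩
    exact single_le_sum (f := fun R => ((h : ℝ) ^ #R)⁻¹) (fun R _ => by positivity) hmem
  calc ∑ g : ι → Fin h, ((h : ℝ) ^ #((univ : Finset ι).image g))⁻¹
      ≤ ∑ g : ι → Fin h, ∑ R ∈ 𝓡.filter (fun R => univ.image g ⊆ R), ((h : ℝ) ^ #R)⁻¹ :=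
        sum_le_sum fun g _ => step1 g
    _ = ∑ g : ι → Fin h, ∑ R ∈ 𝓡, if univ.image g ⊆ R then ((h : ℝ) ^ #R)⁻¹ else 0 := by
        refine sum_congr rfl fun g _ => ?_
        rw [sum_filter]
    _ = ∑ R ∈ 𝓡, ∑ g : ι → Fin h, if univ.image g ⊆ R then ((h : ℝ) ^ #R)⁻¹ else 0 := sum_comm
    _ = ∑ R ∈ 𝓡, (#((univ : Finset (ι → Fin h)).filter fun g => univ.image g ⊆ R) : ℝ) * ((h : ℝ) ^ #R)⁻¹ := by
        refine sum_congr rfl fun R _ => ?_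
        rw [← sum_filter, sum_const, nsmul_eq_mul]
    _ ≤ ∑ R ∈ 𝓡, ((#R : ℝ) ^ q₀) * ((h : ℝ) ^ #R)⁻¹ := by
        refine sum_le_sum fun R _ => ?_
        gcongr
        exact_mod_cast card_filter_image_subset_le R
    _ ≤ ∑ R ∈ 𝓡, ((q₀ : ℝ) ^ q₀) * ((h : ℝ) ^ #R)⁻¹ := by
        refine sum_le_sum fun R hR => ?_
        have hRq : #R ≤ q₀ := (mem_filter.1 hR).2
        gcongr
    _ = ((q₀ : ℝ) ^ q₀) * ∑ R ∈ 𝓡, ((h : ℝ) ^ #R)⁻¹ := by rw [mul_sum]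
    _ ≤ ((q₀ : ℝ) ^ q₀) * (q₀ + 1) := by
        gcongr
        -- group the ranges by cardinality: `#{R : #R = c} = C(h, c) ≤ h^c`
        have hdecomp : 𝓡 = (range (q₀ + 1)).biUnion fun c => (univ : Finset (Fin h)).powersetCard c := by
          ext R
          simp only [𝓡, mem_filter, mem_powerset, mem_biUnion, mem_range, mem_powersetCard]
          constructor
          · rintro ⟨hR, hc⟩; exact ⟨#R, by omega, hR, rfl⟩
          · rintro ⟨c, hc, hR, rfl⟩; exact ⟨hR, by omega⟩
        rw [hdecomp, sum_biUnion]
        · calc ∑ c ∈ range (q₀ + 1), ∑ R ∈ (univ : Finset (Fin h)).powersetCard c, ((h : ℝ) ^ #R)⁻¹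
              = ∑ c ∈ range (q₀ + 1), ((h.choose c : ℕ) : ℝ) * ((h : ℝ) ^ c)⁻¹ := by
                refine sum_congr rfl fun c _ => ?_
                rw [sum_congr rfl fun R hR => by rw [(mem_powersetCard.1 hR).2], sum_const, nsmul_eq_mul,
                  card_powersetCard, card_univ, Fintype.card_fin]
            _ ≤ ∑ _c ∈ range (q₀ + 1), (1 : ℝ) := by
                refine sum_le_sum fun c _ => ?_
                have h1 : ((h.choose c : ℕ) : ℝ) ≤ (h : ℝ) ^ c := by exact_mod_cast Nat.choose_le_pow h c
                have h2 : (0 : ℝ) < (h : ℝ) ^ c := by positivity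
                rw [← div_eq_mul_inv, div_le_one h2]
                exact h1
            _ = q₀ + 1 := by simp
        · intro c _ c' _ hcc
          exact Finset.pairwise_disjoint_powersetCard _ hcc
    _ = (q₀ + 1) * (q₀ : ℝ) ^ q₀ := by ring

end Helpers

/-! ## E. The finite lower bound: the two exits of Jukna's criterion are absurd -/

section Finite

open Classical in
/-- **Exit (ii) is absurd** (positives): if `Ψ ≤ ⋁_{j∈I} x_j ∨ D` with `#I < s'` and `D` an exact
`r'`-DNF of `≤ Z (s'-1)^{r'}` monomials, then `Ψ` rejects all but
`(s'-1) C(n-1,k-3) + Z (s'-1)^{r'} C(n+1-w₀, k-1-w₀)` of the `C(n, k-2)` anchored cliques, while (V1)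
lets it reject at most `ε C(n+2, k)` of them. -/
theorem casePos_absurd (n k w Imax Dmax : ℕ) (ε : ℝ) (hε : 0 ≤ ε) (hk3 : 3 ≤ k) (hkw : w + 1 ≤ k)
    (Ψ : Circuit (Fin (nP (n + 1))))
    (hV1 : (#((posGraphs (n + 2) k).filter (fun x =>
        (thetaGate (n + 1) (k - 1)).2 (fun j => decide (EvalDNF (dd n j) x)) = true ∧
          Ψ.eval (fun j => decide (EvalDNF (dd n j) x)) = false)) : ℝ) ≤ ε * #(posGraphs (n + 2) k))
    (𝓓 : Finset (Finset (Fin (nP (n + 1))))) (I : Finset (Fin (nP (n + 1))))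
    (hDw : ∀ P ∈ 𝓓, (w - 1).choose 2 < #P) (hDcard : #𝓓 ≤ Dmax) (hIcard : #I ≤ Imax)
    (hcase : ∀ v, Ψ.eval v = true → SatClause I v ∨ EvalDNF 𝓓 v)
    (Hii : ε * ((n + 2).choose k : ℝ) + (Imax : ℝ) * ((n - 1).choose (k - 3) : ℝ) +
        (Dmax : ℝ) * ((n + 1 - w).choose (k - 1 - w) : ℝ) < (n.choose (k - 2) : ℝ)) : False := by
  have hq1 : 1 ≤ k - 1 := by omega
  -- the anchored k-sets
  set 𝒦 : Finset (Finset (Fin (n + 2))) := powersetCard k (univ : Finset (Fin (n + 2))) with h𝒦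
  set 𝒜 : Finset (Finset (Fin (n + 2))) := 𝒦.filter (fun K => ({aA n, bB n} : Finset _) ⊆ K) with h𝒜
  have hpair : #({aA n, bB n} : Finset (Fin (n + 2))) = 2 := card_pair (aA_ne_bB n)
  have hA_card : #𝒜 = n.choose (k - 2) := by
    rw [h𝒜, h𝒦, card_filter_supset _ _ (by rw [hpair]; omega), hpair]
    simp
  have haA : ∀ K ∈ 𝒜, aA n ∈ K := fun K hK => (mem_filter.1 hK).2 (mem_insert_self _ _)
  have hbB : ∀ K ∈ 𝒜, bB n ∈ K := fun K hK =>
    (mem_filter.1 hK).2 (mem_insert_of_mem (mem_singleton_self _))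
  -- values on 𝒜
  have hu : ∀ K ∈ 𝒜, (fun j => decide (EvalDNF (dd n j) (cliqueVec K))) =
      fun j => cliqueVec (derS n K) ((eqv (n + 1)).symm j) := fun K hK =>
    dval_eq_cliqueVec n (haA K hK) (hbB K hK)
  have hacc : ∀ K ∈ 𝒜,
      (thetaGate (n + 1) (k - 1)).2 (fun j => decide (EvalDNF (dd n j) (cliqueVec K))) = true := by
    intro K hK
    rw [hu K hK]
    have hKk : #K = k := (mem_powersetCard.1 (mem_filter.1 hK).1).2
    exact thetaGate_accepts (derS n K) (by rw [card_derS n (haA K hK), hKk]) hq1 _ le_rfl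
  -- split 𝒜 by Ψ
  set 𝒜₀ := 𝒜.filter (fun K => Ψ.eval (fun j => decide (EvalDNF (dd n j) (cliqueVec K))) = false)
    with h𝒜₀
  set 𝒜₁ := 𝒜.filter (fun K => ¬ Ψ.eval (fun j => decide (EvalDNF (dd n j) (cliqueVec K))) = false)
    with h𝒜₁
  have hsplit : #𝒜₀ + #𝒜₁ = #𝒜 := Finset.card_filter_add_card_filter_not _
  -- (1) 𝒜₀ is small by (V1)
  have h0 : (#𝒜₀ : ℝ) ≤ ε * (n + 2).choose k := by
    have hinj : Set.InjOn cliqueVec (𝒜₀ : Set (Finset (Fin (n + 2)))) := by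
      intro K hK K' hK' hKK
      exact cliqueVec_inj_of_mem n (haA K (mem_filter.1 (mem_coe.1 hK)).1)
        (haA K' (mem_filter.1 (mem_coe.1 hK')).1) hKK
    have hsub : 𝒜₀.image cliqueVec ⊆ (posGraphs (n + 2) k).filter (fun x =>
        (thetaGate (n + 1) (k - 1)).2 (fun j => decide (EvalDNF (dd n j) x)) = true ∧
          Ψ.eval (fun j => decide (EvalDNF (dd n j) x)) = false) := by
      intro x hx
      obtain ⟨K, hK, rfl⟩ := mem_image.1 hx
      rw [mem_filter] at hK ⊢
      exact ⟨mem_image_of_mem _ (mem_filter.1 hK.1).1, hacc K hK.1, hK.2⟩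
    have hP : #(posGraphs (n + 2) k) ≤ (n + 2).choose k := by
      calc #(posGraphs (n + 2) k) ≤ #𝒦 := card_image_le
        _ = (n + 2).choose k := by simp [h𝒦, card_powersetCard]
    calc (#𝒜₀ : ℝ) = #(𝒜₀.image cliqueVec) := by rw [card_image_of_injOn hinj]
      _ ≤ #((posGraphs (n + 2) k).filter (fun x =>
          (thetaGate (n + 1) (k - 1)).2 (fun j => decide (EvalDNF (dd n j) x)) = true ∧
            Ψ.eval (fun j => decide (EvalDNF (dd n j) x)) = false)) := by
          exact_mod_cast card_le_card hsub
      _ ≤ ε * #(posGraphs (n + 2) k) := hV1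
      _ ≤ ε * (n + 2).choose k := by gcongr
  -- (2) 𝒜₁ is covered by few superset-families
  let T : Fin (nP (n + 1)) → Finset (Fin (n + 2)) := fun j =>
    insert (aA n) ((verts n (pr n j)).map Fin.castSuccEmb)
  let S : Finset (Fin (nP (n + 1))) → Finset (Fin (n + 2)) := fun P =>
    insert (aA n) ((spanV n P).map Fin.castSuccEmb)
  have hcover : 𝒜₁ ⊆ (I.biUnion fun j => 𝒦.filter fun K => T j ⊆ K) ∪
      (𝓓.biUnion fun P => 𝒦.filter fun K => S P ⊆ K) := by
    intro K hK
    rw [mem_filter] at hK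
    obtain ⟨hKA, hΨ⟩ := hK
    have hΨ' : Ψ.eval (fun j => decide (EvalDNF (dd n j) (cliqueVec K))) = true := by
      simpa using hΨ
    have hK𝒦 : K ∈ 𝒦 := (mem_filter.1 hKA).1
    have hon : ∀ j, (fun j => decide (EvalDNF (dd n j) (cliqueVec K))) j = true →
        (verts n (pr n j)).map Fin.castSuccEmb ⊆ K := by
      intro j hj
      rw [hu K hKA] at hj
      intro v hv
      obtain ⟨α, hα, rfl⟩ := Finset.mem_map.1 hv
      simp only [cliqueVec, decide_eq_true_eq] at hj
      have := hj α ((mem_verts n).1 hα)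
      exact (mem_filter.1 this).2
    rcases hcase _ hΨ' with ⟨j, hjI, hj⟩ | ⟨P, hP𝓓, hP⟩
    · refine mem_union_left _ (mem_biUnion.2 ⟨j, hjI, mem_filter.2 ⟨hK𝒦, ?_⟩⟩)
      exact insert_subset (haA K hKA) (hon j hj)
    · refine mem_union_right _ (mem_biUnion.2 ⟨P, hP𝓓, mem_filter.2 ⟨hK𝒦, ?_⟩⟩)
      refine insert_subset (haA K hKA) ?_
      intro v hv
      obtain ⟨α, hα, rfl⟩ := Finset.mem_map.1 hv
      obtain ⟨j, hjP, hαj⟩ := mem_biUnion.1 hα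
      exact hon j (hP j hjP) (Finset.mem_map.2 ⟨α, hαj, rfl⟩)
  -- counts of the covering families
  have hT : ∀ j, #(𝒦.filter fun K => T j ⊆ K) = (n - 1).choose (k - 3) := by
    intro j
    have hTcard : #(T j) = 3 := by
      simp only [T]
      rw [card_insert_of_notMem, card_map, card_verts]
      intro h
      obtain ⟨α, -, hα⟩ := Finset.mem_map.1 h
      exact castSucc_ne_aA n α hα
    rw [h𝒦, card_filter_supset _ _ (by rw [hTcard]; omega), hTcard]
    simp
  have hS : ∀ P ∈ 𝓓, #(𝒦.filter fun K => S P ⊆ K) ≤ (n + 1 - w).choose (k - 1 - w) := by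
    intro P hP
    have hspan : w ≤ #(spanV n P) := le_card_spanV n P w (hDw P hP)
    obtain ⟨W, hWsub, hWcard⟩ := exists_subset_card_eq hspan
    have hS' : insert (aA n) (W.map Fin.castSuccEmb) ⊆ S P :=
      insert_subset_insert _ (map_subset_map.2 hWsub)
    have hcard' : #(insert (aA n) (W.map Fin.castSuccEmb)) = w + 1 := by
      rw [card_insert_of_notMem, card_map, hWcard]
      intro h
      obtain ⟨α, -, hα⟩ := Finset.mem_map.1 h
      exact castSucc_ne_aA n α hα
    calc #(𝒦.filter fun K => S P ⊆ K)
        ≤ #(𝒦.filter fun K => insert (aA n) (W.map Fin.castSuccEmb) ⊆ K) :=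
          card_filter_supset_mono hS' k
      _ = (Fintype.card (Fin (n + 2)) - (w + 1)).choose (k - (w + 1)) := by
          rw [h𝒦, card_filter_supset _ _ (by rw [hcard']; omega), hcard']
      _ = (n + 1 - w).choose (k - 1 - w) := by
          rw [Fintype.card_fin]
          congr 1 <;> omega
  have h1 : (#𝒜₁ : ℝ) ≤ (Imax : ℝ) * (n - 1).choose (k - 3) +
      (Dmax : ℝ) * (n + 1 - w).choose (k - 1 - w) := by
    have h2 : #𝒜₁ ≤ #I * (n - 1).choose (k - 3) + #𝓓 * (n + 1 - w).choose (k - 1 - w) := by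
      calc #𝒜₁ ≤ #((I.biUnion fun j => 𝒦.filter fun K => T j ⊆ K) ∪
              (𝓓.biUnion fun P => 𝒦.filter fun K => S P ⊆ K)) := card_le_card hcover
        _ ≤ #(I.biUnion fun j => 𝒦.filter fun K => T j ⊆ K) +
              #(𝓓.biUnion fun P => 𝒦.filter fun K => S P ⊆ K) := card_union_le _ _
        _ ≤ ∑ j ∈ I, #(𝒦.filter fun K => T j ⊆ K) + ∑ P ∈ 𝓓, #(𝒦.filter fun K => S P ⊆ K) :=
            add_le_add card_biUnion_le card_biUnion_le
        _ ≤ ∑ _j ∈ I, (n - 1).choose (k - 3) + ∑ _P ∈ 𝓓, (n + 1 - w).choose (k - 1 - w) :=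
            add_le_add (sum_le_sum fun j _ => (hT j).le) (sum_le_sum fun P hP => hS P hP)
        _ = #I * (n - 1).choose (k - 3) + #𝓓 * (n + 1 - w).choose (k - 1 - w) := by
            simp [sum_const, smul_eq_mul]
    have h3 : (#𝒜₁ : ℝ) ≤ #I * (n - 1).choose (k - 3) + #𝓓 * (n + 1 - w).choose (k - 1 - w) := by
      exact_mod_cast h2
    refine h3.trans ?_
    have hI' : (#I : ℝ) ≤ (Imax : ℝ) := by exact_mod_cast hIcard
    have hD' : (#𝓓 : ℝ) ≤ (Dmax : ℝ) := by exact_mod_cast hDcard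
    have hC1 : (0 : ℝ) ≤ (n - 1).choose (k - 3) := Nat.cast_nonneg _
    have hC2 : (0 : ℝ) ≤ (n + 1 - w).choose (k - 1 - w) := Nat.cast_nonneg _
    nlinarith [mul_le_mul_of_nonneg_right hI' hC1, mul_le_mul_of_nonneg_right hD' hC2]
  -- conclude
  have htot : (n.choose (k - 2) : ℝ) = #𝒜₀ + #𝒜₁ := by
    rw [← hA_card, ← hsplit]; push_cast; ring
  linarith [h0, h1, Hii, htot]

open Classical in
/-- **Exit (i) is absurd** (negatives): if `C ≤ Ψ` for an exact `s'`-CNF `C` of `≤ Z (r'-1)^{s'}`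
clauses, then `Ψ` accepts all but few of the fully classified anchored negatives, which the gate
rejects, against (V2). -/
theorem caseNeg_absurd (n k t h Cmax s' v e Dm : ℕ) (ε : ℝ) (hε : 0 ≤ ε)
    (hh1 : 1 ≤ h) (hh2 : 2 * h ≤ n) (hhk : h < k - 1)
    (hD1 : 1 ≤ Dm) (hhD : h ^ 2 ≤ Dm ^ 3)
    (htD : (t - 1) * Dm ≤ Fintype.card (EV n) - 1) (hts : 2 * s' + 2 ≤ t)
    (htN : t ≤ Fintype.card (EV n)) (hss : (v - 1).choose 2 < s') (hve : 4 * e ≤ v)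
    (Ψ : Circuit (Fin (nP (n + 1))))
    (hV2 : (#((((powersetCard t (univ : Finset (EV n))).image (fun M => fun e => decide (e ∉ M)))).filter
        (fun x => Ψ.eval (fun j => decide (EvalCNF (cc n h j) x)) = true ∧
          (thetaGate (n + 1) (k - 1)).2 (fun j => decide (EvalCNF (cc n h j) x)) = false)) : ℝ) ≤
        ε * #(((powersetCard t (univ : Finset (EV n))).image (fun M => fun e => decide (e ∉ M)))))
    (𝓒 : Finset (Finset (Fin (nP (n + 1))))) (hCw : ∀ Q ∈ 𝓒, #Q = s')
    (hCcard : #𝓒 ≤ Cmax)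
    (hcase : ∀ u, EvalCNF 𝓒 u → Ψ.eval u = true)
    (Hi : (n + 1 : ℝ) * ((Fintype.card (EV n) - 1 - h).choose (t - 1) : ℝ) +
        ε * ((Fintype.card (EV n)).choose t : ℝ) +
        (Cmax : ℝ) * ((((s' : ℕ) : ℝ) + 1) * ((s' : ℕ) : ℝ) ^ s' *
          ((Fintype.card (EV n) - 1).choose (t - 1) : ℝ) / (Dm : ℝ) ^ e) <
        ((Fintype.card (EV n) - 1).choose (t - 1) : ℝ)) : False := by
  set NN := Fintype.card (EV n) with hNN
  set ℳ : Finset (Finset (EV n)) := powersetCard t (univ : Finset (EV n)) with hℳ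
  set ℬ : Finset (Finset (EV n)) := ℳ.filter (fun M => e0 n ∈ M) with hℬ
  have ht1 : 1 ≤ t := by omega
  have hℬcard : #ℬ = (NN - 1).choose (t - 1) := by
    have h1 := card_filter_supset ({e0 n} : Finset (EV n)) t (by rw [card_singleton]; exact ht1)
    rw [card_singleton] at h1
    rw [hℬ, hℳ, ← h1]
    congr 1
    exact filter_congr fun M _ => by rw [singleton_subset_iff]
  -- classified / classless anchored negatives
  set ℬ₀ := ℬ.filter (fun M => ∀ α : Fin (n + 1), ∃ γ, γ < h ∧ fE n α γ ∈ M) with hℬ₀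
  set ℬbad := ℬ.filter (fun M => ¬ ∀ α : Fin (n + 1), ∃ γ, γ < h ∧ fE n α γ ∈ M) with hℬbad
  have hsplit1 : #ℬ₀ + #ℬbad = #ℬ := Finset.card_filter_add_card_filter_not _
  -- the classless ones are few
  have hbad : #ℬbad ≤ (n + 1) * (NN - 1 - h).choose (t - 1) := by
    have hcov : ℬbad ⊆ (univ : Finset (Fin (n + 1))).biUnion fun α => ℳ.filter fun M =>
        ({e0 n} : Finset (EV n)) ⊆ M ∧ Disjoint ((range h).image (fE n α)) M := by
      intro M hM
      rw [mem_filter] at hM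
      obtain ⟨hMℬ, hbadM⟩ := hM
      simp only [not_forall, not_exists, not_and] at hbadM
      obtain ⟨α, hα⟩ := hbadM
      refine mem_biUnion.2 ⟨α, mem_univ _, mem_filter.2 ⟨(mem_filter.1 hMℬ).1, ?_, ?_⟩⟩
      · exact singleton_subset_iff.2 (mem_filter.1 hMℬ).2
      · exact disjoint_left.2 fun e he heM => by
          obtain ⟨γ, hγ, rfl⟩ := mem_image.1 he
          exact hα γ (mem_range.1 hγ) heM
    have hF : ∀ α : Fin (n + 1), #((range h).image (fE n α)) = h := by
      intro α
      rw [card_image_of_injOn, card_range]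
      intro γ hγ γ' hγ' hγγ
      exact (fE_inj n hh2 (mem_range.1 (mem_coe.1 hγ)) (mem_range.1 (mem_coe.1 hγ')) hγγ).2
    have hdisj : ∀ α : Fin (n + 1), Disjoint ({e0 n} : Finset (EV n)) ((range h).image (fE n α)) := by
      intro α
      rw [disjoint_singleton_left]
      intro he
      obtain ⟨γ, hγ, hγe⟩ := mem_image.1 he
      exact fE_ne_e0 n α (by have := mem_range.1 hγ; omega) hγe
    calc #ℬbad ≤ ∑ α : Fin (n + 1), #(ℳ.filter fun M =>
          ({e0 n} : Finset (EV n)) ⊆ M ∧ Disjoint ((range h).image (fE n α)) M) :=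
          (card_le_card hcov).trans card_biUnion_le
      _ = ∑ _α : Fin (n + 1), (NN - (1 + h)).choose (t - 1) := by
          refine sum_congr rfl fun α _ => ?_
          rw [hℳ, card_filter_supset_disjoint _ _ (hdisj α) t (by rw [card_singleton]; exact ht1),
            card_singleton, hF]
      _ = (n + 1) * (NN - 1 - h).choose (t - 1) := by
          rw [sum_const, smul_eq_mul, card_univ, Fintype.card_fin, Nat.sub_sub]
  -- the gate rejects every fully classified anchored negative
  have hrej : ∀ M ∈ ℬ₀, (thetaGate (n + 1) (k - 1)).2
      (fun j => decide (EvalCNF (cc n h j) (fun e => decide (e ∉ M)))) = false := by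
    intro M hM
    rw [mem_filter] at hM
    obtain ⟨hMℬ, hgood⟩ := hM
    have he : e0 n ∈ M := (mem_filter.1 hMℬ).2
    exact thetaGate_rejects (col n h M hgood) hhk _ (cval_le_colorVec n hh2 he hgood)
  -- split ℬ₀ by Ψ
  set ℬp := ℬ₀.filter (fun M =>
    Ψ.eval (fun j => decide (EvalCNF (cc n h j) (fun e => decide (e ∉ M)))) = true) with hℬp
  set ℬm := ℬ₀.filter (fun M =>
    ¬ Ψ.eval (fun j => decide (EvalCNF (cc n h j) (fun e => decide (e ∉ M)))) = true) with hℬm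
  have hsplit2 : #ℬp + #ℬm = #ℬ₀ := Finset.card_filter_add_card_filter_not _
  -- ℬp is small by (V2)
  have hplus : (#ℬp : ℝ) ≤ ε * NN.choose t := by
    have hinj : Set.InjOn (fun (M : Finset (EV n)) => fun e => decide (e ∉ M)) (ℬp : Set _) :=
      (negVec_injective n).injOn
    have hsub : ℬp.image (fun M => fun e => decide (e ∉ M)) ⊆
        (ℳ.image (fun M => fun e => decide (e ∉ M))).filter (fun x =>
          Ψ.eval (fun j => decide (EvalCNF (cc n h j) x)) = true ∧
            (thetaGate (n + 1) (k - 1)).2 (fun j => decide (EvalCNF (cc n h j) x)) = false) := by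
      intro x hx
      obtain ⟨M, hM, rfl⟩ := mem_image.1 hx
      rw [mem_filter] at hM ⊢
      exact ⟨mem_image_of_mem _ (mem_filter.1 (mem_filter.1 hM.1).1).1, hM.2, hrej M hM.1⟩
    have hN : #(ℳ.image (fun M => fun e => decide (e ∉ M))) ≤ NN.choose t := by
      calc _ ≤ #ℳ := card_image_le
        _ = NN.choose t := by simp [hℳ, card_powersetCard, hNN]
    calc (#ℬp : ℝ) = #(ℬp.image (fun M => fun e => decide (e ∉ M))) := by
          rw [card_image_of_injOn hinj]
      _ ≤ #((ℳ.image (fun M => fun e => decide (e ∉ M))).filter (fun x =>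
          Ψ.eval (fun j => decide (EvalCNF (cc n h j) x)) = true ∧
            (thetaGate (n + 1) (k - 1)).2 (fun j => decide (EvalCNF (cc n h j) x)) = false)) := by
          exact_mod_cast card_le_card hsub
      _ ≤ ε * #(ℳ.image (fun M => fun e => decide (e ∉ M))) := hV2
      _ ≤ ε * NN.choose t := by gcongr
  -- ℬm is covered by the off-events of the exact clauses
  have hminus_cov : ℬm ⊆ 𝓒.biUnion fun Q => ℳ.filter fun M =>
      e0 n ∈ M ∧ ∀ j ∈ Q, ∃ γ, γ < h ∧ ∀ α ∈ verts n (pr n j), fE n α γ ∈ M := by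
    intro M hM
    rw [mem_filter] at hM
    obtain ⟨hM0, hΨ⟩ := hM
    have hMℬ : M ∈ ℬ := (mem_filter.1 hM0).1
    have he : e0 n ∈ M := (mem_filter.1 hMℬ).2
    have hnot : ¬ EvalCNF 𝓒 (fun j => decide (EvalCNF (cc n h j) (fun e => decide (e ∉ M)))) :=
      fun hev => hΨ (hcase _ hev)
    have hex : ∃ Q ∈ 𝓒, ¬ SatClause Q (fun j => decide (EvalCNF (cc n h j) (fun e => decide (e ∉ M)))) := by
      by_contra hall
      exact hnot fun Q hQ => by_contra fun hs => hall ⟨Q, hQ, hs⟩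
    obtain ⟨Q, hQ, hQsat⟩ := hex
    refine mem_biUnion.2 ⟨Q, hQ, mem_filter.2 ⟨(mem_filter.1 hMℬ).1, he, fun j hj => ?_⟩⟩
    have hoff : decide (EvalCNF (cc n h j) (fun e => decide (e ∉ M))) = false := by
      cases hb : decide (EvalCNF (cc n h j) (fun e => decide (e ∉ M))) with
      | false => rfl
      | true => exact absurd ⟨j, hj, hb⟩ hQsat
    exact (cval_false_iff n hh2 he j).1 hoff
  -- per-clause bound
  have hbound_nonneg : (0 : ℝ) ≤ (((s' : ℕ) : ℝ) + 1) * ((s' : ℕ) : ℝ) ^ s' *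
      ((NN - 1).choose (t - 1) : ℝ) / (Dm : ℝ) ^ e := by positivity
  have hQ : ∀ Q ∈ 𝓒, (#(ℳ.filter fun M =>
      e0 n ∈ M ∧ ∀ j ∈ Q, ∃ γ, γ < h ∧ ∀ α ∈ verts n (pr n j), fE n α γ ∈ M) : ℝ) ≤
      (((s' : ℕ) : ℝ) + 1) * ((s' : ℕ) : ℝ) ^ s' * ((NN - 1).choose (t - 1) : ℝ) / (Dm : ℝ) ^ e := by
    intro Q hQ𝓒
    have hQcard : #Q = s' := hCw Q hQ𝓒
    -- cover by class assignments `g : Q → Fin h`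
    have hcov : (ℳ.filter fun M =>
        e0 n ∈ M ∧ ∀ j ∈ Q, ∃ γ, γ < h ∧ ∀ α ∈ verts n (pr n j), fE n α γ ∈ M) ⊆
        (univ : Finset (Q → Fin h)).biUnion fun g => ℳ.filter fun M => Gset n g ⊆ M := by
      intro M hM
      rw [mem_filter] at hM
      obtain ⟨hMℳ, he, hall⟩ := hM
      choose γf hγf hγM using hall
      refine mem_biUnion.2 ⟨fun j => ⟨γf j.1 j.2, hγf j.1 j.2⟩, mem_univ _, mem_filter.2 ⟨hMℳ, ?_⟩⟩
      intro e he'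
      rw [Gset, mem_insert] at he'
      rcases he' with rfl | he'
      · exact he
      · obtain ⟨x, hx, rfl⟩ := mem_image.1 he'
        obtain ⟨j, hxj, hgj⟩ := (mem_Inc_iff _ x).1 hx
        have h1 := hγM j.1 j.2 x.1 hxj
        have h2 : γf j.1 j.2 = x.2.1 := by rw [← hgj]
        rw [h2] at h1
        exact h1
    -- per-assignment bound
    have hNN2 : 2 ≤ NN := by omega
    have hg : ∀ g : Q → Fin h, (#(ℳ.filter fun M => Gset n g ⊆ M) : ℝ) *
        ((h : ℝ) ^ #((univ : Finset Q).image g) * (Dm : ℝ) ^ e) ≤ (NN - 1).choose (t - 1) := by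
      intro g
      set ι := #(Inc g) with hι
      have hιle : ι ≤ 2 * s' := by rw [hι, ← hQcard]; exact card_Inc_le g
      have hGcard : #(Gset n g) = ι + 1 := card_Gset hh2 g
      have hcnt : #(ℳ.filter fun M => Gset n g ⊆ M) = (NN - (ι + 1)).choose (t - (ι + 1)) := by
        rw [hℳ, card_filter_supset _ _ (by rw [hGcard]; omega), hGcard]
      have hratio := choose_sub_sub_mul_pow_le (NN - 1) (t - 1) (by omega) ι (by omega)
      have hpow : ((t - 1) * Dm) ^ ι ≤ (NN - 1) ^ ι := Nat.pow_le_pow_left htD ι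
      have hmain : (NN - 1 - ι).choose (t - 1 - ι) * Dm ^ ι ≤ (NN - 1).choose (t - 1) := by
        have hNNpos : 0 < (NN - 1) ^ ι := Nat.pow_pos (by omega)
        refine Nat.le_of_mul_le_mul_right ?_ hNNpos
        calc (NN - 1 - ι).choose (t - 1 - ι) * Dm ^ ι * (NN - 1) ^ ι
            = (NN - 1 - ι).choose (t - 1 - ι) * (NN - 1) ^ ι * Dm ^ ι := by ring
          _ ≤ (NN - 1).choose (t - 1) * (t - 1) ^ ι * Dm ^ ι := Nat.mul_le_mul_right _ hratio
          _ = (NN - 1).choose (t - 1) * ((t - 1) * Dm) ^ ι := by ring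
          _ ≤ (NN - 1).choose (t - 1) * (NN - 1) ^ ι := Nat.mul_le_mul_left _ hpow
      set c := #((univ : Finset Q).image g) with hc
      have hι1 : v ≤ ι :=
        (le_card_spanV n Q v (by rw [hQcard]; exact hss)).trans (card_spanV_le_card_Inc g)
      have hι2 : 2 * c ≤ ι := two_mul_card_image_le_card_Inc g
      have hmax : max (4 * e) (2 * c) ≤ ι := max_le (by omega) hι2
      have hkey : h ^ c * Dm ^ e ≤ Dm ^ ι :=
        (pow_mul_pow_le_pow_max hhD hD1 c e).trans (Nat.pow_le_pow_right hD1 hmax)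
      have hfin : (NN - (ι + 1)).choose (t - (ι + 1)) * (h ^ c * Dm ^ e) ≤
          (NN - 1).choose (t - 1) := by
        have e1 : NN - (ι + 1) = NN - 1 - ι := by omega
        have e2 : t - (ι + 1) = t - 1 - ι := by omega
        rw [e1, e2]
        exact (Nat.mul_le_mul_left _ hkey).trans hmain
      rw [hcnt]
      exact_mod_cast hfin
    have hhpos : (0 : ℝ) < h := by exact_mod_cast hh1
    have hDpos : (0 : ℝ) < Dm := by exact_mod_cast hD1
    calc (#(ℳ.filter fun M =>
          e0 n ∈ M ∧ ∀ j ∈ Q, ∃ γ, γ < h ∧ ∀ α ∈ verts n (pr n j), fE n α γ ∈ M) : ℝ)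
        ≤ #((univ : Finset (Q → Fin h)).biUnion fun g => ℳ.filter fun M => Gset n g ⊆ M) := by
          exact_mod_cast card_le_card hcov
      _ ≤ ∑ g : Q → Fin h, (#(ℳ.filter fun M => Gset n g ⊆ M) : ℝ) := by
          exact_mod_cast card_biUnion_le
      _ ≤ ∑ g : Q → Fin h, ((NN - 1).choose (t - 1) : ℝ) /
            ((h : ℝ) ^ #((univ : Finset Q).image g) * (Dm : ℝ) ^ e) := by
          refine sum_le_sum fun g _ => ?_
          rw [le_div_iff₀ (by positivity)]
          exact hg g
      _ = ((NN - 1).choose (t - 1) : ℝ) / (Dm : ℝ) ^ e *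
            ∑ g : Q → Fin h, ((h : ℝ) ^ #((univ : Finset Q).image g))⁻¹ := by
          rw [mul_sum]
          refine sum_congr rfl fun g _ => ?_
          rw [div_eq_mul_inv, div_eq_mul_inv, mul_inv]
          ring
      _ ≤ ((NN - 1).choose (t - 1) : ℝ) / (Dm : ℝ) ^ e *
            ((Fintype.card Q + 1) * (Fintype.card Q : ℝ) ^ (Fintype.card Q)) := by
          gcongr
          exact sum_inv_pow_card_image_le h hh1
      _ = (((s' : ℕ) : ℝ) + 1) * ((s' : ℕ) : ℝ) ^ s' * ((NN - 1).choose (t - 1) : ℝ) / (Dm : ℝ) ^ e := by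
          rw [Fintype.card_coe, hQcard]
          ring
  have hminus : (#ℬm : ℝ) ≤ (Cmax : ℝ) *
      ((((s' : ℕ) : ℝ) + 1) * ((s' : ℕ) : ℝ) ^ s' * ((NN - 1).choose (t - 1) : ℝ) / (Dm : ℝ) ^ e) := by
    have hC' : (#𝓒 : ℝ) ≤ (Cmax : ℝ) := by exact_mod_cast hCcard
    calc (#ℬm : ℝ) ≤ #(𝓒.biUnion fun Q => ℳ.filter fun M =>
          e0 n ∈ M ∧ ∀ j ∈ Q, ∃ γ, γ < h ∧ ∀ α ∈ verts n (pr n j), fE n α γ ∈ M) := by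
          exact_mod_cast card_le_card hminus_cov
      _ ≤ ∑ Q ∈ 𝓒, (#(ℳ.filter fun M =>
          e0 n ∈ M ∧ ∀ j ∈ Q, ∃ γ, γ < h ∧ ∀ α ∈ verts n (pr n j), fE n α γ ∈ M) : ℝ) := by
          exact_mod_cast card_biUnion_le
      _ ≤ ∑ _Q ∈ 𝓒, (((s' : ℕ) : ℝ) + 1) * ((s' : ℕ) : ℝ) ^ s' * ((NN - 1).choose (t - 1) : ℝ) /
            (Dm : ℝ) ^ e := sum_le_sum hQ
      _ = #𝓒 * ((((s' : ℕ) : ℝ) + 1) * ((s' : ℕ) : ℝ) ^ s' * ((NN - 1).choose (t - 1) : ℝ) /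
            (Dm : ℝ) ^ e) := by rw [sum_const, nsmul_eq_mul]
      _ ≤ _ := mul_le_mul_of_nonneg_right hC' hbound_nonneg
  -- assemble
  have htot : ((NN - 1).choose (t - 1) : ℝ) = #ℬbad + #ℬp + #ℬm := by
    rw [← hℬcard, ← hsplit1, ← hsplit2]; push_cast; ring
  have hbad' : (#ℬbad : ℝ) ≤ (n + 1) * (NN - 1 - h).choose (t - 1) := by exact_mod_cast hbad
  linarith [hplus, hminus, Hi, htot, hbad']

end Finite

/-! ## F. Asymptotics of the line's parameters `k = ⌈m^{1/4}⌉₊`, `D = ⌊m^{1/8}⌋₊` -/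

section Asymptotics

theorem rpow_quarter_pow_four (m : ℕ) : (((m : ℝ) ^ (1 / 4 : ℝ)) ^ 4) = (m : ℝ) := by
  rw [← Real.rpow_natCast, ← Real.rpow_mul (Nat.cast_nonneg m)]
  norm_num

theorem rpow_eighth_pow_eight (m : ℕ) : (((m : ℝ) ^ (1 / 8 : ℝ)) ^ 8) = (m : ℝ) := by
  rw [← Real.rpow_natCast, ← Real.rpow_mul (Nat.cast_nonneg m)]
  norm_num

/-- `m ≤ k⁴ ≤ 16 m` for `k = ⌈m^{1/4}⌉₊`, `m ≥ 1`. -/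
theorem ceil_quarter_bounds (m : ℕ) (hm : 1 ≤ m) :
    m ≤ (⌈(m : ℝ) ^ (1 / 4 : ℝ)⌉₊) ^ 4 ∧ (⌈(m : ℝ) ^ (1 / 4 : ℝ)⌉₊) ^ 4 ≤ 16 * m := by
  set x : ℝ := (m : ℝ) ^ (1 / 4 : ℝ) with hx
  have hx0 : 0 ≤ x := by positivity
  have hx1 : 1 ≤ x := Real.one_le_rpow (by exact_mod_cast hm) (by norm_num)
  have hxm : x ^ 4 = m := rpow_quarter_pow_four m
  have h1 : x ≤ ⌈x⌉₊ := Nat.le_ceil x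
  have h2 : (⌈x⌉₊ : ℝ) < x + 1 := Nat.ceil_lt_add_one hx0
  constructor
  · have : (m : ℝ) ≤ ((⌈x⌉₊ ^ 4 : ℕ) : ℝ) := by
      rw [← hxm]; push_cast
      exact pow_le_pow_left₀ hx0 h1 4
    exact_mod_cast this
  · have h3 : (⌈x⌉₊ : ℝ) ≤ 2 * x := by linarith
    have : ((⌈x⌉₊ ^ 4 : ℕ) : ℝ) ≤ ((16 * m : ℕ) : ℝ) := by
      push_cast
      calc (⌈x⌉₊ : ℝ) ^ 4 ≤ (2 * x) ^ 4 := pow_le_pow_left₀ (by positivity) h3 4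
        _ = 16 * x ^ 4 := by ring
        _ = 16 * m := by rw [hxm]
    exact_mod_cast this

/-- `D⁸ ≤ m < (D+1)⁸` and `1 ≤ D` for `D = ⌊m^{1/8}⌋₊`, `m ≥ 1`. -/
theorem floor_eighth_bounds (m : ℕ) (hm : 1 ≤ m) :
    (⌊(m : ℝ) ^ (1 / 8 : ℝ)⌋₊) ^ 8 ≤ m ∧ m < (⌊(m : ℝ) ^ (1 / 8 : ℝ)⌋₊ + 1) ^ 8 ∧
      1 ≤ ⌊(m : ℝ) ^ (1 / 8 : ℝ)⌋₊ := by
  set y : ℝ := (m : ℝ) ^ (1 / 8 : ℝ) with hy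
  have hy0 : 0 ≤ y := by positivity
  have hy1 : 1 ≤ y := Real.one_le_rpow (by exact_mod_cast hm) (by norm_num)
  have hym : y ^ 8 = m := rpow_eighth_pow_eight m
  have h1 : (⌊y⌋₊ : ℝ) ≤ y := Nat.floor_le hy0
  have h2 : y < ⌊y⌋₊ + 1 := Nat.lt_floor_add_one y
  refine ⟨?_, ?_, ?_⟩
  · have : ((⌊y⌋₊ ^ 8 : ℕ) : ℝ) ≤ (m : ℝ) := by
      rw [← hym]; push_cast
      exact pow_le_pow_left₀ (by positivity) h1 8
    exact_mod_cast this
  · have : (m : ℝ) < (((⌊y⌋₊ + 1) ^ 8 : ℕ) : ℝ) := by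
      rw [← hym]; push_cast
      exact pow_lt_pow_left₀ h2 hy0 (by norm_num)
    exact_mod_cast this
  · exact Nat.le_floor (by exact_mod_cast hy1)

/-- `⌊√⌊m^{1/8}⌋₊⌋ → ∞`. -/
theorem tendsto_sqrt_floor_eighth :
    Tendsto (fun m : ℕ => Nat.sqrt ⌊(m : ℝ) ^ (1 / 8 : ℝ)⌋₊) atTop atTop := by
  refine tendsto_atTop_atTop.2 fun b => ⟨(b ^ 2) ^ 8, fun m hm => ?_⟩
  rw [Nat.le_sqrt, ← sq]
  refine Nat.le_floor ?_
  have h1 : (((b : ℝ) ^ 2) ^ 8) ≤ m := by exact_mod_cast hm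
  have h2 : ((b : ℝ) ^ 2) = (((b : ℝ) ^ 2) ^ 8) ^ (1 / 8 : ℝ) := by
    rw [← Real.rpow_natCast _ 8, ← Real.rpow_mul (by positivity)]
    norm_num
  rw [Nat.cast_pow, h2]
  exact Real.rpow_le_rpow (by positivity) h1 (by norm_num)

/-- Exponential beats polynomial along the line's parameters: eventually `4 m (2/3)^{⌊√D⌋} ≤ 1`. -/
theorem eventually_decay :
    ∀ᶠ m : ℕ in atTop, 4 * (m : ℝ) * (2 / 3 : ℝ) ^ Nat.sqrt ⌊(m : ℝ) ^ (1 / 8 : ℝ)⌋₊ ≤ 1 := by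
  have hlim := tendsto_pow_const_mul_const_pow_of_abs_lt_one 16 (r := (2 / 3 : ℝ))
    (by rw [abs_of_nonneg (by norm_num)]; norm_num)
  have hc : (0 : ℝ) < 1 / (4 * 2 ^ 16) := by norm_num
  have hev : ∀ᶠ q : ℕ in atTop, (q : ℝ) ^ 16 * (2 / 3 : ℝ) ^ q < 1 / (4 * 2 ^ 16) :=
    (tendsto_order.1 hlim).2 _ hc
  have hev1 : ∀ᶠ q : ℕ in atTop, 1 ≤ q := eventually_ge_atTop 1
  have key := tendsto_sqrt_floor_eighth.eventually (hev.and hev1)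
  have hm1 : ∀ᶠ m : ℕ in atTop, 1 ≤ m := eventually_ge_atTop 1
  filter_upwards [key, hm1] with m hm hm1'
  obtain ⟨hq, hq1⟩ := hm
  set D := ⌊(m : ℝ) ^ (1 / 8 : ℝ)⌋₊ with hD
  set q := Nat.sqrt D with hq'
  -- m < (D+1)^8 ≤ (q+1)^16 ≤ (2q)^16
  have h1 : m < (D + 1) ^ 8 := (floor_eighth_bounds m hm1').2.1
  have h2 : D + 1 ≤ (q + 1) ^ 2 := Nat.succ_le_of_lt (Nat.lt_succ_sqrt' D)
  have h3 : (D + 1) ^ 8 ≤ (q + 1) ^ 16 := by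
    calc (D + 1) ^ 8 ≤ ((q + 1) ^ 2) ^ 8 := Nat.pow_le_pow_left h2 8
      _ = (q + 1) ^ 16 := by ring
  have h4 : (q + 1) ^ 16 ≤ (2 * q) ^ 16 := Nat.pow_le_pow_left (by omega) 16
  have hmq : (m : ℝ) ≤ (2 * (q : ℝ)) ^ 16 := by
    have : m ≤ (2 * q) ^ 16 := by omega
    exact_mod_cast this
  have hpos : (0 : ℝ) ≤ (2 / 3 : ℝ) ^ q := by positivity
  calc 4 * (m : ℝ) * (2 / 3 : ℝ) ^ q ≤ 4 * (2 * (q : ℝ)) ^ 16 * (2 / 3 : ℝ) ^ q := by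
        gcongr
    _ = 4 * 2 ^ 16 * ((q : ℝ) ^ 16 * (2 / 3 : ℝ) ^ q) := by ring
    _ ≤ 4 * 2 ^ 16 * (1 / (4 * 2 ^ 16)) := by gcongr
    _ = 1 := by norm_num

/-- Bernoulli: `(1 - 1/(2D))^D ≤ 2/3` for `D ≥ 1`. -/
theorem one_sub_pow_le_two_thirds (D : ℕ) (hD : 1 ≤ D) : (1 - 1 / (2 * (D : ℝ))) ^ D ≤ 2 / 3 := by
  have hDpos : (0 : ℝ) < D := by exact_mod_cast hD
  have hD1 : (1 : ℝ) ≤ D := by exact_mod_cast hD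
  set x : ℝ := 1 / (2 * (D : ℝ)) with hx
  have hx0 : 0 ≤ x := by positivity
  have hx1 : x ≤ 1 / 2 := by
    rw [hx, div_le_div_iff₀ (by positivity) (by norm_num)]
    linarith
  have hB : 1 + (D : ℝ) * x ≤ (1 + x) ^ D := one_add_mul_le_pow (by linarith) D
  have hDx : (D : ℝ) * x = 1 / 2 := by rw [hx]; field_simp
  have h1 : (1 - x) ^ D * (1 + x) ^ D ≤ 1 := by
    rw [← mul_pow]
    have : (1 - x) * (1 + x) ≤ 1 := by nlinarith
    exact pow_le_one₀ (by nlinarith) this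
  have h2 : 0 ≤ (1 - x) ^ D := pow_nonneg (by linarith) D
  have h3 : (1 - x) ^ D * (3 / 2) ≤ 1 := by
    calc (1 - x) ^ D * (3 / 2) = (1 - x) ^ D * (1 + (D : ℝ) * x) := by rw [hDx]; ring
      _ ≤ (1 - x) ^ D * (1 + x) ^ D := mul_le_mul_of_nonneg_left hB h2
      _ ≤ 1 := h1
  linarith

/-- The number of edge slots of `K_{n+2}` is `C(n+2, 2)`. -/
theorem card_EV (n : ℕ) : Fintype.card (EV n) = (n + 2).choose 2 := by
  rw [← SimpleGraph.edgeFinset_card, SimpleGraph.card_edgeFinset_top_eq_card_choose_two,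
    Fintype.card_fin]

end Asymptotics

/-! ## G. The numeric side conditions, and the refutation -/

section Numeric

/-- The positive-side budget (hypothesis `Hii` of `casePos_absurd`) at the line's parameters. -/
theorem numeric_pos (n k a s1 : ℕ) (hk3 : 3 ≤ k) (hkw : w0 a + 1 ≤ k) (hkn : k ≤ n + 2)
    (hk16 : k ^ 4 ≤ 16 * (n + 2)) (h4sk : 4 * s1 * k ≤ n)
    (hT2 : 4 * s1 ^ rr a * 256 ^ (a + 1) ≤ n + 2) (h16 : 16 ≤ n + 2) :
    (1 / (8 * ((n + 2 : ℕ) : ℝ) ^ (3 + 1))) * ((n + 2).choose k : ℝ) +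
      (s1 : ℝ) * ((n - 1).choose (k - 3) : ℝ) +
      (((n + 2) ^ a * s1 ^ rr a : ℕ) : ℝ) * ((n + 1 - w0 a).choose (k - 1 - w0 a) : ℝ) <
      (n.choose (k - 2) : ℝ) := by
  set C := n.choose (k - 2) with hC
  have hkn2 : k - 2 ≤ n := by omega
  have hCpos : 1 ≤ C := Nat.choose_pos hkn2
  -- (a) C(n+2, k) ≤ (n+2)² C
  have ha : (n + 2).choose k ≤ (n + 2) ^ 2 * C := by
    have hmul := Nat.choose_mul (n := n + 2) (k := k) (s := 2) (by omega)
    -- hmul : (n+2).choose k * k.choose 2 = (n+2).choose 2 * (n + 2 - 2).choose (k - 2)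
    have h2 : 1 ≤ k.choose 2 := Nat.choose_pos (by omega)
    have h3 : (n + 2).choose 2 ≤ (n + 2) ^ 2 := Nat.choose_le_pow _ _
    calc (n + 2).choose k ≤ (n + 2).choose k * k.choose 2 := Nat.le_mul_of_pos_right _ h2
      _ = (n + 2).choose 2 * (n + 2 - 2).choose (k - 2) := hmul
      _ = (n + 2).choose 2 * C := by rw [hC]; rfl
      _ ≤ (n + 2) ^ 2 * C := Nat.mul_le_mul_right _ h3
  -- (b) 4 s1 C(n-1, k-3) ≤ C
  have hb : 4 * s1 * (n - 1).choose (k - 3) ≤ C := by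
    rcases Nat.eq_zero_or_pos n with hn0 | hnpos
    · subst hn0
      have : k - 2 = 0 := by omega
      omega
    have hid := Nat.add_one_mul_choose_eq (n - 1) (k - 3)
    rw [show n - 1 + 1 = n by omega, show k - 3 + 1 = k - 2 by omega] at hid
    -- hid : n * (n-1).choose (k-3) = C * (k - 2)
    refine Nat.le_of_mul_le_mul_right ?_ hnpos
    calc 4 * s1 * (n - 1).choose (k - 3) * n = 4 * s1 * (n * (n - 1).choose (k - 3)) := by ring
      _ = 4 * s1 * (C * (k - 2)) := by rw [hid]
      _ = C * (4 * s1 * (k - 2)) := by ring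
      _ ≤ C * n := Nat.mul_le_mul_left _ (by
          calc 4 * s1 * (k - 2) ≤ 4 * s1 * k := Nat.mul_le_mul_left _ (Nat.sub_le _ _)
            _ ≤ n := h4sk)
  -- (c) 4 (n+2)^a s1^R C(n+1-w0, k-1-w0) ≤ C
  have hc : 4 * ((n + 2) ^ a * s1 ^ rr a) * (n + 1 - w0 a).choose (k - 1 - w0 a) ≤ C := by
    set X := (n + 1 - w0 a).choose (k - 1 - w0 a) with hX
    have hw1 : w0 a - 1 = 4 * (a + 1) := by rw [w0_eq]; omega
    have hratio := choose_sub_sub_mul_pow_le n (k - 2) hkn2 (w0 a - 1) (by omega)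
    rw [show n - (w0 a - 1) = n + 1 - w0 a by rw [w0_eq]; omega,
      show k - 2 - (w0 a - 1) = k - 1 - w0 a by rw [w0_eq]; omega, hw1] at hratio
    -- hratio : X * n ^ (4 (a+1)) ≤ C * (k - 2) ^ (4 (a+1))
    have h1 : (k - 2) ^ (4 * (a + 1)) ≤ (16 * (n + 2)) ^ (a + 1) := by
      calc (k - 2) ^ (4 * (a + 1)) ≤ k ^ (4 * (a + 1)) := Nat.pow_le_pow_left (Nat.sub_le _ _) _
        _ = (k ^ 4) ^ (a + 1) := by rw [pow_mul]
        _ ≤ (16 * (n + 2)) ^ (a + 1) := Nat.pow_le_pow_left hk16 _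
    have h2 : (n + 2) ^ 4 ≤ 16 * n ^ 4 := by
      have : n + 2 ≤ 2 * n := by omega
      calc (n + 2) ^ 4 ≤ (2 * n) ^ 4 := Nat.pow_le_pow_left this 4
        _ = 16 * n ^ 4 := by ring
    have h3 : X * (n + 2) ^ (4 * (a + 1)) ≤ 256 ^ (a + 1) * (n + 2) ^ (a + 1) * C := by
      calc X * (n + 2) ^ (4 * (a + 1)) = X * ((n + 2) ^ 4) ^ (a + 1) := by rw [pow_mul]
        _ ≤ X * (16 * n ^ 4) ^ (a + 1) := Nat.mul_le_mul_left _ (Nat.pow_le_pow_left h2 _)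
        _ = 16 ^ (a + 1) * (X * n ^ (4 * (a + 1))) := by rw [mul_pow, ← pow_mul]; ring
        _ ≤ 16 ^ (a + 1) * (C * (k - 2) ^ (4 * (a + 1))) := Nat.mul_le_mul_left _ hratio
        _ ≤ 16 ^ (a + 1) * (C * (16 * (n + 2)) ^ (a + 1)) :=
            Nat.mul_le_mul_left _ (Nat.mul_le_mul_left _ h1)
        _ = 256 ^ (a + 1) * (n + 2) ^ (a + 1) * C := by
            rw [mul_pow, show (256 : ℕ) ^ (a + 1) = 16 ^ (a + 1) * 16 ^ (a + 1) by
              rw [← mul_pow]; norm_num]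
            ring
    have hpos : 0 < (n + 2) ^ (4 * (a + 1)) := Nat.pow_pos (by omega)
    refine Nat.le_of_mul_le_mul_right ?_ hpos
    calc 4 * ((n + 2) ^ a * s1 ^ rr a) * X * (n + 2) ^ (4 * (a + 1))
        = 4 * (n + 2) ^ a * s1 ^ rr a * (X * (n + 2) ^ (4 * (a + 1))) := by ring
      _ ≤ 4 * (n + 2) ^ a * s1 ^ rr a * (256 ^ (a + 1) * (n + 2) ^ (a + 1) * C) :=
          Nat.mul_le_mul_left _ h3
      _ = (4 * s1 ^ rr a * 256 ^ (a + 1)) * ((n + 2) ^ a * (n + 2) ^ (a + 1)) * C := by ring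
      _ ≤ (n + 2) * ((n + 2) ^ a * (n + 2) ^ (a + 1)) * C := by gcongr
      _ = (n + 2) ^ (2 * a + 2) * C := by ring
      _ ≤ (n + 2) ^ (4 * (a + 1)) * C :=
          Nat.mul_le_mul_right _ (Nat.pow_le_pow_right (by omega) (by omega))
      _ = C * (n + 2) ^ (4 * (a + 1)) := by ring
  -- assemble in ℝ
  have hm0 : (0 : ℝ) < ((n + 2 : ℕ) : ℝ) := by positivity
  have haR : ((n + 2).choose k : ℝ) ≤ ((n + 2 : ℕ) : ℝ) ^ 2 * C := by exact_mod_cast ha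
  have hbR : 4 * (s1 : ℝ) * ((n - 1).choose (k - 3) : ℝ) ≤ C := by exact_mod_cast hb
  have hcR : 4 * (((n + 2) ^ a * s1 ^ rr a : ℕ) : ℝ) * ((n + 1 - w0 a).choose (k - 1 - w0 a) : ℝ) ≤ C := by
    exact_mod_cast hc
  have hCR : (1 : ℝ) ≤ C := by exact_mod_cast hCpos
  have h1 : (1 / (8 * ((n + 2 : ℕ) : ℝ) ^ (3 + 1))) * ((n + 2).choose k : ℝ) ≤ (C : ℝ) / 8 := by
    have hm1 : (1 : ℝ) ≤ ((n + 2 : ℕ) : ℝ) := by exact_mod_cast (show 1 ≤ n + 2 by omega)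
    have hm2 : ((n + 2 : ℕ) : ℝ) ^ 2 ≤ ((n + 2 : ℕ) : ℝ) ^ (3 + 1) := pow_le_pow_right₀ hm1 (by norm_num)
    rw [div_mul_eq_mul_div, one_mul, div_le_div_iff₀ (by positivity) (by norm_num)]
    calc ((n + 2).choose k : ℝ) * 8 ≤ ((n + 2 : ℕ) : ℝ) ^ 2 * C * 8 := by gcongr
      _ ≤ ((n + 2 : ℕ) : ℝ) ^ (3 + 1) * C * 8 := by gcongr
      _ = C * (8 * ((n + 2 : ℕ) : ℝ) ^ (3 + 1)) := by ring
  linarith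

/-- The negative-side budget (hypothesis `Hi` of `caseNeg_absurd`) at the line's parameters. -/
theorem numeric_neg (n NN t h q Dm a Cm s' : ℕ) (hD1 : 1 ≤ Dm) (hDn : Dm ≤ n + 2)
    (htD : NN < Dm * (t + 1)) (h4D : 4 * Dm ≤ NN) (ht1 : 1 ≤ t)
    (htN : t ≤ NN) (hhN : h ≤ NN - 1) (hhq : h = Dm * q)
    (hdec : 4 * ((n + 2 : ℕ) : ℝ) * (2 / 3 : ℝ) ^ q ≤ 1)
    (hCm : 4 * (Cm * ((s' + 1) * s' ^ s')) * 256 ^ (a + 1) ≤ (n + 2) ^ (a + 1))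
    (hn8 : n + 2 < (Dm + 1) ^ 8) :
    (n + 1 : ℝ) * ((NN - 1 - h).choose (t - 1) : ℝ) +
      (1 / (8 * ((n + 2 : ℕ) : ℝ) ^ (3 + 1))) * (NN.choose t : ℝ) +
      (Cm : ℝ) * ((((s' : ℕ) : ℝ) + 1) * ((s' : ℕ) : ℝ) ^ s' * ((NN - 1).choose (t - 1) : ℝ) /
        (Dm : ℝ) ^ (8 * (a + 1))) <
      ((NN - 1).choose (t - 1) : ℝ) := by
  set B := (NN - 1).choose (t - 1) with hB
  have hBpos : 1 ≤ B := Nat.choose_pos (by omega)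
  have hBR : (1 : ℝ) ≤ B := by exact_mod_cast hBpos
  have hB0 : (0 : ℝ) ≤ B := by positivity
  have hNN1 : 1 ≤ NN := by omega
  -- (i-c) 4 Cm S ≤ Dm^{8(a+1)}
  have hc : 4 * (Cm * ((s' + 1) * s' ^ s')) ≤ Dm ^ (8 * (a + 1)) := by
    have h1 : n + 2 ≤ 256 * Dm ^ 8 := by
      calc n + 2 ≤ (Dm + 1) ^ 8 := hn8.le
        _ ≤ (2 * Dm) ^ 8 := Nat.pow_le_pow_left (by omega) 8
        _ = 256 * Dm ^ 8 := by ring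
    have h2 : (n + 2) ^ (a + 1) ≤ 256 ^ (a + 1) * Dm ^ (8 * (a + 1)) := by
      calc (n + 2) ^ (a + 1) ≤ (256 * Dm ^ 8) ^ (a + 1) := Nat.pow_le_pow_left h1 _
        _ = 256 ^ (a + 1) * Dm ^ (8 * (a + 1)) := by rw [mul_pow, ← pow_mul]
    have hpos : 0 < 256 ^ (a + 1) := Nat.pow_pos (by norm_num)
    refine Nat.le_of_mul_le_mul_right ?_ hpos
    calc 4 * (Cm * ((s' + 1) * s' ^ s')) * 256 ^ (a + 1) ≤ (n + 2) ^ (a + 1) := hCm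
      _ ≤ 256 ^ (a + 1) * Dm ^ (8 * (a + 1)) := h2
      _ = Dm ^ (8 * (a + 1)) * 256 ^ (a + 1) := by ring
  have hcR : 4 * ((Cm : ℝ) * ((((s' : ℕ) : ℝ) + 1) * ((s' : ℕ) : ℝ) ^ s')) ≤ (Dm : ℝ) ^ (8 * (a + 1)) := by
    exact_mod_cast hc
  have hDpow : (0 : ℝ) < (Dm : ℝ) ^ (8 * (a + 1)) := by positivity
  have U3 : (Cm : ℝ) * ((((s' : ℕ) : ℝ) + 1) * ((s' : ℕ) : ℝ) ^ s' * (B : ℝ) / (Dm : ℝ) ^ (8 * (a + 1))) ≤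
      (B : ℝ) / 4 := by
    rw [mul_div_assoc', div_le_div_iff₀ hDpow (by norm_num)]
    calc (Cm : ℝ) * ((((s' : ℕ) : ℝ) + 1) * ((s' : ℕ) : ℝ) ^ s' * (B : ℝ)) * 4
        = (4 * ((Cm : ℝ) * ((((s' : ℕ) : ℝ) + 1) * ((s' : ℕ) : ℝ) ^ s'))) * B := by ring
      _ ≤ (Dm : ℝ) ^ (8 * (a + 1)) * B := mul_le_mul_of_nonneg_right hcR hB0
      _ = B * (Dm : ℝ) ^ (8 * (a + 1)) := by ring
  -- (i-b) C(NN, t) ≤ 2 Dm B, so ε C(NN,t) ≤ B/4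
  have hb : NN.choose t ≤ 2 * Dm * B := by
    have hid := Nat.add_one_mul_choose_eq (NN - 1) (t - 1)
    rw [show NN - 1 + 1 = NN by omega, show t - 1 + 1 = t by omega] at hid
    -- hid : NN * B = NN.choose t * t
    have h1 : NN ≤ 2 * Dm * t := by nlinarith
    refine Nat.le_of_mul_le_mul_right ?_ (show 0 < t by omega)
    calc NN.choose t * t = NN * B := hid.symm
      _ ≤ 2 * Dm * t * B := Nat.mul_le_mul_right _ h1
      _ = 2 * Dm * B * t := by ring
  have U2 : (1 / (8 * ((n + 2 : ℕ) : ℝ) ^ (3 + 1))) * (NN.choose t : ℝ) ≤ (B : ℝ) / 4 := by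
    have hbR : (NN.choose t : ℝ) ≤ 2 * (Dm : ℝ) * B := by exact_mod_cast hb
    have hm1 : (1 : ℝ) ≤ ((n + 2 : ℕ) : ℝ) := by exact_mod_cast (show 1 ≤ n + 2 by omega)
    have hDm : (Dm : ℝ) ≤ ((n + 2 : ℕ) : ℝ) := by exact_mod_cast hDn
    have hm4 : ((n + 2 : ℕ) : ℝ) ≤ ((n + 2 : ℕ) : ℝ) ^ (3 + 1) := by
      calc ((n + 2 : ℕ) : ℝ) = ((n + 2 : ℕ) : ℝ) ^ 1 := (pow_one _).symm
        _ ≤ ((n + 2 : ℕ) : ℝ) ^ (3 + 1) := pow_le_pow_right₀ hm1 (by norm_num)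
    rw [div_mul_eq_mul_div, one_mul, div_le_div_iff₀ (by positivity) (by norm_num)]
    calc (NN.choose t : ℝ) * 4 ≤ 2 * (Dm : ℝ) * B * 4 := by gcongr
      _ = B * (8 * (Dm : ℝ)) := by ring
      _ ≤ B * (8 * ((n + 2 : ℕ) : ℝ) ^ (3 + 1)) := by gcongr; exact hDm.trans hm4
  -- (i-a) (n+1) C(NN-1-h, t-1) ≤ B/4
  have U1 : (n + 1 : ℝ) * ((NN - 1 - h).choose (t - 1) : ℝ) ≤ (B : ℝ) / 4 := by
    have hratio := choose_sub_mul_pow_le (NN - 1) (t - 1) h hhN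
    rw [show NN - 1 - (t - 1) = NN - t by omega] at hratio
    -- hratio : C(NN-1-h, t-1) * (NN-1)^h ≤ B * (NN - t)^h
    have hNN1R : (0 : ℝ) < ((NN - 1 : ℕ) : ℝ) := by
      have : 1 ≤ NN - 1 := by omega
      exact_mod_cast this
    have hratioR : (((NN - 1 - h).choose (t - 1) : ℕ) : ℝ) * ((NN - 1 : ℕ) : ℝ) ^ h ≤
        (B : ℝ) * ((NN - t : ℕ) : ℝ) ^ h := by exact_mod_cast hratio
    -- the ratio (NN - t)/(NN - 1) ≤ 1 - 1/(2 Dm)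
    have hkey : ((NN - t : ℕ) : ℝ) ≤ ((NN - 1 : ℕ) : ℝ) * (1 - 1 / (2 * (Dm : ℝ))) := by
      have hDR : (0 : ℝ) < Dm := by exact_mod_cast hD1
      have e1 : ((NN - t : ℕ) : ℝ) = (NN : ℝ) - t := by push_cast [Nat.cast_sub htN]; ring
      have e2 : ((NN - 1 : ℕ) : ℝ) = (NN : ℝ) - 1 := by push_cast [Nat.cast_sub hNN1]; ring
      rw [e1, e2]
      have h2 : (NN : ℝ) + 2 * Dm ≤ 2 * Dm * t + 1 := by
        have : NN + 2 * Dm ≤ 2 * Dm * t + 1 := by nlinarith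
        exact_mod_cast this
      have hDR2 : (0 : ℝ) < 2 * Dm := by positivity
      have key : ((NN : ℝ) - 1) / (2 * Dm) ≤ (t : ℝ) - 1 := by
        rw [div_le_iff₀ hDR2]; nlinarith
      have e3 : ((NN : ℝ) - 1) * (1 - 1 / (2 * Dm)) = (NN - 1) - (NN - 1) / (2 * Dm) := by ring
      rw [e3]
      linarith [key]
    have hfac0 : (0 : ℝ) ≤ 1 - 1 / (2 * (Dm : ℝ)) := by
      have hDR : (1 : ℝ) ≤ Dm := by exact_mod_cast hD1
      have : 1 / (2 * (Dm : ℝ)) ≤ 1 / 2 := by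
        rw [div_le_div_iff₀ (by positivity) (by norm_num)]; linarith
      linarith
    have hpow : ((NN - t : ℕ) : ℝ) ^ h ≤ ((NN - 1 : ℕ) : ℝ) ^ h * (1 - 1 / (2 * (Dm : ℝ))) ^ h := by
      rw [← mul_pow]
      exact pow_le_pow_left₀ (by positivity) hkey h
    have hbern : (1 - 1 / (2 * (Dm : ℝ))) ^ h ≤ (2 / 3 : ℝ) ^ q := by
      rw [hhq, pow_mul]
      exact pow_le_pow_left₀ (pow_nonneg hfac0 _) (one_sub_pow_le_two_thirds Dm hD1) q
    -- combine: C(NN-1-h,t-1) ≤ B (2/3)^q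
    have hX : (((NN - 1 - h).choose (t - 1) : ℕ) : ℝ) ≤ (B : ℝ) * (2 / 3 : ℝ) ^ q := by
      have hpos : (0 : ℝ) < ((NN - 1 : ℕ) : ℝ) ^ h := by positivity
      have := calc (((NN - 1 - h).choose (t - 1) : ℕ) : ℝ) * ((NN - 1 : ℕ) : ℝ) ^ h
          ≤ (B : ℝ) * ((NN - t : ℕ) : ℝ) ^ h := hratioR
        _ ≤ (B : ℝ) * (((NN - 1 : ℕ) : ℝ) ^ h * (1 - 1 / (2 * (Dm : ℝ))) ^ h) :=
            mul_le_mul_of_nonneg_left hpow hB0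
        _ ≤ (B : ℝ) * (((NN - 1 : ℕ) : ℝ) ^ h * (2 / 3 : ℝ) ^ q) := by gcongr
        _ = (B : ℝ) * (2 / 3 : ℝ) ^ q * ((NN - 1 : ℕ) : ℝ) ^ h := by ring
      exact le_of_mul_le_mul_right this hpos
    have hn1 : (n + 1 : ℝ) ≤ ((n + 2 : ℕ) : ℝ) := by push_cast; linarith
    calc (n + 1 : ℝ) * ((NN - 1 - h).choose (t - 1) : ℝ) ≤ ((n + 2 : ℕ) : ℝ) * ((B : ℝ) * (2 / 3 : ℝ) ^ q) := by
          gcongr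
      _ = (B : ℝ) / 4 * (4 * ((n + 2 : ℕ) : ℝ) * (2 / 3 : ℝ) ^ q) := by ring
      _ ≤ (B : ℝ) / 4 * 1 := by gcongr
      _ = (B : ℝ) / 4 := by ring
  linarith

end Numeric

/-! ## H. The refutation of the registered stub -/

section Main

/-- Pure arithmetic: every side condition of the two finite exits follows from the base facts
`m ≤ k⁴ ≤ 16 m`, `D⁸ ≤ m`, `1 ≤ D` and explicit polynomial thresholds on `m = n + 2`. -/
theorem params_ok (n a S k Dm NN t : ℕ) (h16 : 16 ≤ n + 2)
    (hT1 : (64 * S + 4 * a + 40) ^ 4 ≤ n + 2) (hT4 : 4 * S + 6 ≤ n + 2)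
    (hkm : n + 2 ≤ k ^ 4) (hk16 : k ^ 4 ≤ 16 * (n + 2))
    (hD8 : Dm ^ 8 ≤ n + 2) (hD1 : 1 ≤ Dm)
    (hNN : NN = (n + 2).choose 2) (ht : t = NN / Dm) :
    (3 ≤ k ∧ 4 * a + 6 ≤ k ∧ k ≤ n + 2 ∧ 4 * (S - 1) * k ≤ n) ∧
    (Dm ≤ n + 2 ∧ 1 ≤ Dm * Nat.sqrt Dm ∧ 2 * (Dm * Nat.sqrt Dm) ≤ n ∧
      Dm * Nat.sqrt Dm < k - 1 ∧ (Dm * Nat.sqrt Dm) ^ 2 ≤ Dm ^ 3) ∧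
    (4 * Dm ≤ NN ∧ NN < Dm * (t + 1) ∧ 2 * S + 2 ≤ t ∧ t ≤ NN ∧ (t - 1) * Dm ≤ NN - 1 ∧
      Dm * Nat.sqrt Dm ≤ NN - 1) := by
  set q : ℕ := Nat.sqrt Dm with hq
  -- k
  have hK0 : 64 * S + 4 * a + 40 ≤ k :=
    (Nat.pow_le_pow_iff_left (by norm_num : (4 : ℕ) ≠ 0)).1 (hT1.trans hkm)
  have hk3 : 3 ≤ k := by omega
  have hkn : k ≤ n + 2 := by
    have h1 : 16 * k ≤ k ^ 4 := by
      have : 16 ≤ k ^ 3 := le_trans (by norm_num : 16 ≤ 3 ^ 3) (Nat.pow_le_pow_left hk3 3)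
      calc 16 * k ≤ k ^ 3 * k := Nat.mul_le_mul_right k this
        _ = k ^ 4 := by ring
    omega
  have h4sk : 4 * (S - 1) * k ≤ n := by
    have h1 : 16 * (4 * S * k + 2) ≤ (64 * S + 32) * k := by
      have e1 : 16 * (4 * S * k + 2) = 64 * (S * k) + 32 := by ring
      have e2 : (64 * S + 32) * k = 64 * (S * k) + 32 * k := by ring
      omega
    have h2 : (64 * S + 32) * k ≤ k * k := Nat.mul_le_mul_right k (by omega)
    have h3 : k * k ≤ k ^ 4 := by
      calc k * k = k ^ 2 := (sq k).symm
        _ ≤ k ^ 4 := Nat.pow_le_pow_right (by omega) (by norm_num)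
    have h4 : 4 * (S - 1) * k ≤ 4 * S * k := Nat.mul_le_mul_right k (by omega)
    omega
  -- D, q, h
  have hDm_le : Dm ≤ n + 2 := le_trans (Nat.le_self_pow (by norm_num) Dm) hD8
  have hDsq_k : Dm * Dm ≤ k := by
    have : (Dm * Dm) ^ 4 ≤ k ^ 4 := by
      calc (Dm * Dm) ^ 4 = Dm ^ 8 := by ring
        _ ≤ n + 2 := hD8
        _ ≤ k ^ 4 := hkm
    exact (Nat.pow_le_pow_iff_left (by norm_num : (4 : ℕ) ≠ 0)).1 this
  have hq1 : 1 ≤ q := Nat.le_sqrt.2 (by omega)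
  have hqD : q * q ≤ Dm := Nat.sqrt_le Dm
  have hq_le : q ≤ Dm := Nat.sqrt_le_self Dm
  have hh1 : 1 ≤ Dm * q := Nat.mul_le_mul hD1 hq1
  have hh_sq : (Dm * q) ^ 2 ≤ Dm ^ 3 := by
    calc (Dm * q) ^ 2 = Dm ^ 2 * (q * q) := by ring
      _ ≤ Dm ^ 2 * Dm := Nat.mul_le_mul_left _ hqD
      _ = Dm ^ 3 := by ring
  have hh_le : Dm * q ≤ Dm * Dm := Nat.mul_le_mul_left _ hq_le
  have hDD8 : Dm * Dm ≤ n + 2 := by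
    calc Dm * Dm = Dm ^ 2 := (sq Dm).symm
      _ ≤ Dm ^ 8 := Nat.pow_le_pow_right hD1 (by norm_num)
      _ ≤ n + 2 := hD8
  have hh2 : 2 * (Dm * q) ≤ n := by
    rcases Nat.lt_or_ge Dm 2 with hlt | hge
    · have hD : Dm = 1 := by omega
      have h1 : Dm * q ≤ 1 := by rw [hD] at hh_le ⊢; simpa using hh_le
      omega
    · have h6 : 64 ≤ Dm ^ 6 := le_trans (by norm_num : 64 ≤ 2 ^ 6) (Nat.pow_le_pow_left hge 6)
      have h7 : 64 * (Dm * Dm) ≤ n + 2 := by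
        calc 64 * (Dm * Dm) ≤ Dm ^ 6 * (Dm * Dm) := Nat.mul_le_mul_right _ h6
          _ = Dm ^ 8 := by ring
          _ ≤ n + 2 := hD8
      omega
  have hhk : Dm * q < k - 1 := by
    rcases Nat.lt_or_ge Dm 4 with hlt | hge
    · have hq1' : q ≤ 1 := by
        rcases Nat.lt_or_ge q 2 with h2 | h2
        · omega
        · have := Nat.mul_le_mul h2 h2; omega
      have : Dm * q ≤ 3 := by
        calc Dm * q ≤ 3 * 1 := Nat.mul_le_mul (by omega) hq1'
          _ = 3 := by norm_num
      omega
    · have hq2 : 2 ≤ q := Nat.le_sqrt.2 (by omega)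
      have h2q : 2 * q ≤ Dm := le_trans (Nat.mul_le_mul_right q hq2) hqD
      have : 2 * (Dm * q) ≤ Dm * Dm := by
        calc 2 * (Dm * q) = Dm * (2 * q) := by ring
          _ ≤ Dm * Dm := Nat.mul_le_mul_left _ h2q
      omega
  -- NN, t
  have hNN2 : NN * 2 = (n + 2) * (n + 1) := by
    have h := Nat.add_one_mul_choose_eq (n + 1) 1
    simp only [Nat.choose_one_right, show n + 1 + 1 = n + 2 from rfl, show 1 + 1 = 2 from rfl] at h
    rw [hNN]
    linarith
  have h4D : 4 * Dm ≤ NN := by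
    have h1 : (n + 2) * 8 ≤ (n + 2) * (n + 1) := Nat.mul_le_mul_left _ (by omega)
    omega
  have hDt : t * Dm ≤ NN := by rw [ht]; exact Nat.div_mul_le_self NN Dm
  have htD' : NN < Dm * (t + 1) := by
    have h1 := Nat.div_add_mod NN Dm
    have h2 := Nat.mod_lt NN (show 0 < Dm by omega)
    have h3 : Dm * (NN / Dm + 1) = Dm * (NN / Dm) + Dm := by ring
    rw [ht, h3]
    omega
  have hts : 2 * S + 2 ≤ t := by
    rw [ht, Nat.le_div_iff_mul_le (by omega)]
    calc (2 * S + 2) * Dm ≤ (2 * S + 2) * (n + 2) := Nat.mul_le_mul_left _ hDm_le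
      _ ≤ NN := by
          refine Nat.le_of_mul_le_mul_right ?_ (by norm_num : 0 < 2)
          calc (2 * S + 2) * (n + 2) * 2 = (n + 2) * (2 * (2 * S + 2)) := by ring
            _ ≤ (n + 2) * (n + 1) := Nat.mul_le_mul_left _ (by omega)
            _ = NN * 2 := hNN2.symm
  have htN : t ≤ NN := by rw [ht]; exact Nat.div_le_self NN Dm
  have htD : (t - 1) * Dm ≤ NN - 1 := by
    have e := Nat.sub_one_mul t Dm
    have hv : t * Dm ≤ NN := hDt
    have hD : 1 ≤ Dm := hD1
    omega
  have hhN : Dm * q ≤ NN - 1 := by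
    have h1 : Dm * q ≤ n + 2 := hh_le.trans hDD8
    have h2 : (n + 2) * 3 ≤ (n + 2) * (n + 1) := Nat.mul_le_mul_left _ (by omega)
    omega
  exact ⟨⟨hk3, by omega, hkn, h4sk⟩, ⟨hDm_le, hh1, hh2, hhk, hh_sq⟩,
    ⟨h4D, htD', hts, htN, htD, hhN⟩⟩

theorem theta_width_le (n : ℕ) (hn : 2 ≤ n) : 4 * (n + 1) ^ 2 + 4 ≤ (n + 2) ^ 3 := by
  nlinarith

open Classical in
/-- **`stub_convReplaceable` (line `width-threshold-certificate-sparsity` of crux stmt-PneNP-10682,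
`ConvReplaceableStatement`) is FALSE.** At `c = 3`, for EVERY size exponent `a` and the localities
`r = 3, s = 4`, at every large `m = n + 2` the anchored theta gate `thetaGate (n+1) (k-1)`
(`k = ⌈m^{1/4}⌉₊`, a CONV gate of description `≤ m³`) with the children `dd n`, `cc n h`
(`h = D ⌊√D⌋`, `D = ⌊m^{1/8}⌋₊`) admits NO monotone `{∧,∨,0,1}`-circuit `Ψ` with `≤ m^a` gates that
accepts all but `ε #posFam` of the positives the gate accepts and rejects all but `ε #negFam` of the
negatives the gate rejects (`ε = 1/(8 m⁴)`): Jukna's criterion (`Circuit.lowerBoundsCriterion`) run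
on the DERIVED coordinates has both exits absurd (`casePos_absurd`, `caseNeg_absurd`). The statement
below is the registered stub signature verbatim. -/
theorem stub_convReplaceable_false :
    ¬ (∀ c : ℕ, ∃ a : ℕ, ∀ r s : ℕ, 2 ≤ r → 2 ≤ s → ∀ᶠ m : ℕ in atTop, ∀ φ : GateFn,
      IsConvGate (m ^ c) φ →
      ∀ (D C : Fin φ.1 → Finset (Finset ((⊤ : SimpleGraph (Fin m)).edgeSet))),
        #(univ.image fun j => (D j, C j)) ≤ m ^ (c + 3) →
        (∀ j, ∀ R ∈ D j, #R ≤ r - 1) → (∀ j, ∀ S ∈ C j, #S ≤ s - 1) →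
        (∀ j x, EvalDNF (D j) x → EvalCNF (C j) x) →
        ∃ Ψ : Circuit (Fin φ.1), Ψ.IsOver monotoneBasis01 ∧ Ψ.size ≤ m ^ a ∧
          (#((posGraphs m ⌈(m : ℝ) ^ (1 / 4 : ℝ)⌉₊).filter (fun x =>
              φ.2 (fun j => decide (EvalDNF (D j) x)) = true ∧
                Ψ.eval (fun j => decide (EvalDNF (D j) x)) = false)) : ℝ) ≤
            (1 / (8 * (m : ℝ) ^ (c + 1))) * #(posGraphs m ⌈(m : ℝ) ^ (1 / 4 : ℝ)⌉₊) ∧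
          (#((((powersetCard (Fintype.card ((⊤ : SimpleGraph (Fin m)).edgeSet) /
              ⌊(m : ℝ) ^ (1 / 8 : ℝ)⌋₊) (univ : Finset ((⊤ : SimpleGraph (Fin m)).edgeSet))).image
                (fun M => fun e => decide (e ∉ M)))).filter (fun x =>
              Ψ.eval (fun j => decide (EvalCNF (C j) x)) = true ∧
                φ.2 (fun j => decide (EvalCNF (C j) x)) = false)) : ℝ) ≤
            (1 / (8 * (m : ℝ) ^ (c + 1))) *
              #(((powersetCard (Fintype.card ((⊤ : SimpleGraph (Fin m)).edgeSet) /
                ⌊(m : ℝ) ^ (1 / 8 : ℝ)⌋₊) (univ : Finset ((⊤ : SimpleGraph (Fin m)).edgeSet))).image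
                  (fun M => fun e => decide (e ∉ M))))) := by
  intro H
  obtain ⟨a, Ha⟩ := H 3
  have Hev := Ha 3 4 (by norm_num) (by norm_num)
  -- explicit thresholds (all eventually true)
  have T0 : ∀ᶠ m : ℕ in atTop, 16 ≤ m := eventually_ge_atTop 16
  have T1 : ∀ᶠ m : ℕ in atTop, (64 * ss a + 4 * a + 40) ^ 4 ≤ m := eventually_ge_atTop _
  have T2 : ∀ᶠ m : ℕ in atTop, 4 * (ss a - 1) ^ rr a * 256 ^ (a + 1) ≤ m := eventually_ge_atTop _
  have T3 : ∀ᶠ m : ℕ in atTop,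
      4 * ((rr a - 1) ^ ss a * ((ss a + 1) * ss a ^ ss a)) * 256 ^ (a + 1) ≤ m :=
    eventually_ge_atTop _
  have T4 : ∀ᶠ m : ℕ in atTop, 4 * ss a + 6 ≤ m := eventually_ge_atTop _
  obtain ⟨m, hmain, h16, hT1, hT2, hT3, hT4, hdec⟩ :=
    (Hev.and (T0.and (T1.and (T2.and (T3.and (T4.and eventually_decay)))))).exists
  -- m = n + 2
  obtain ⟨n, rfl⟩ : ∃ n, m = n + 2 := ⟨m - 2, by omega⟩
  have hm1 : 1 ≤ n + 2 := by omega
  -- base facts about k = ⌈m^{1/4}⌉₊ and D = ⌊m^{1/8}⌋₊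
  obtain ⟨hkm, hk16⟩ := ceil_quarter_bounds (n + 2) hm1
  obtain ⟨hD8, hD8', hD1⟩ := floor_eighth_bounds (n + 2) hm1
  set k : ℕ := ⌈((n + 2 : ℕ) : ℝ) ^ (1 / 4 : ℝ)⌉₊ with hk
  set Dm : ℕ := ⌊((n + 2 : ℕ) : ℝ) ^ (1 / 8 : ℝ)⌋₊ with hDm
  set q : ℕ := Nat.sqrt Dm with hq
  set h : ℕ := Dm * q with hh
  set NN : ℕ := Fintype.card (EV n) with hNNdef
  set t : ℕ := NN / Dm with ht
  obtain ⟨⟨hk3, hk46, hkn, h4sk⟩, ⟨hDm_le, hh1, hh2, hhk, hh_sq⟩, ⟨h4D, htD', hts, htN, htD, hhN⟩⟩ :=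
    params_ok n a (ss a) k Dm NN t h16 hT1 hT4 hkm hk16 hD8 hD1 (card_EV n) rfl
  have hkw : w0 a + 1 ≤ k := by rw [w0_eq]; omega
  have ht1 : 1 ≤ t := by omega
  -- the gate, the children, and the stub's circuit
  have hconv : IsConvGate ((n + 2) ^ 3) (thetaGate (n + 1) (k - 1)) :=
    (thetaGate_isConvGate (n + 1) (k - 1)).mono (theta_width_le n (by omega))
  obtain ⟨Ψ, hΨB, hΨsz, hV1, hV2⟩ := hmain (thetaGate (n + 1) (k - 1)) hconv (dd n) (cc n h)
    ((card_pairs_le n h).trans (Nat.pow_le_pow_right (by omega) (by norm_num)))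
    (dd_local n) (cc_local n h) (dd_le_cc n h)
  obtain ⟨𝓒, 𝓓, I, hCw, hDw, hCcard, hDcard, hIcard, hcases⟩ :=
    Ψ.lowerBoundsCriterion hΨB (f := Ψ.eval) (fun _ => rfl) (two_le_rr a) (two_le_ss a)
  rcases hcases with hc1 | hc2
  · -- exit (i): negatives
    have hCm : 4 * ((n + 2) ^ a * (rr a - 1) ^ ss a * ((ss a + 1) * ss a ^ ss a)) * 256 ^ (a + 1) ≤
        (n + 2) ^ (a + 1) := by
      calc 4 * ((n + 2) ^ a * (rr a - 1) ^ ss a * ((ss a + 1) * ss a ^ ss a)) * 256 ^ (a + 1)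
          = (n + 2) ^ a * (4 * ((rr a - 1) ^ ss a * ((ss a + 1) * ss a ^ ss a)) * 256 ^ (a + 1)) := by
            ring
        _ ≤ (n + 2) ^ a * (n + 2) := Nat.mul_le_mul_left _ hT3
        _ = (n + 2) ^ (a + 1) := (pow_succ _ _).symm
    have hnum := numeric_neg n NN t h q Dm a ((n + 2) ^ a * (rr a - 1) ^ ss a) (ss a) hD1 hDm_le
      htD' h4D ht1 htN hhN rfl hdec hCm hD8'
    exact caseNeg_absurd n k t h ((n + 2) ^ a * (rr a - 1) ^ ss a) (ss a) (v0 a) (8 * (a + 1)) Dm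
      (1 / (8 * ((n + 2 : ℕ) : ℝ) ^ (3 + 1))) (by positivity) hh1 hh2 hhk hD1 hh_sq htD hts htN
      (by rw [ss_eq]; exact Nat.lt_succ_self _) (by rw [v0_eq]; omega) Ψ hV2 𝓒 hCw
      (hCcard.trans (Nat.mul_le_mul_right _ hΨsz)) hc1 hnum
  · -- exit (ii): positives
    have hnum := numeric_pos n k a (ss a - 1) hk3 hkw hkn hk16 h4sk hT2 h16
    exact casePos_absurd n k (w0 a) (ss a - 1) ((n + 2) ^ a * (ss a - 1) ^ rr a)
      (1 / (8 * ((n + 2 : ℕ) : ℝ) ^ (3 + 1))) (by positivity) hk3 hkw Ψ hV1 𝓓 I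
      (fun P hP => by rw [hDw P hP, rr_eq]; exact Nat.lt_succ_self _)
      (hDcard.trans (Nat.mul_le_mul_right _ hΨsz)) hIcard hc2 hnum

end Main
end

end Summit.PneNP.PneNP.Theorems.CliqueExtLowerBound.Negative
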